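import Mathlib
import Literature.MathematicalPhysics.QuantumFieldTheory.MagnenRivasseauSeneor1993.MRS93FaddeevPopovUnity
import Literature.MathematicalPhysics.QuantumFieldTheory.MagnenRivasseauSeneor1993.MRS93GhostReintegrationWindow
import HarnessLib

/-!
# Magnen–Rivasseau–Sénéor, *Construction of YM₄ with an infrared cutoff* (CMP 155, 1993), §II.A p.333 — display
# (II.20) «1 = det[K(A)] ∫dγ e^{−(ζ/2)(∂_μA_μ^{γ,∞})²}» FOR THE CUT-OFF FADDEEV–POPOV OPERATOR ITSELF: the WINDOW
# MATRIX `K_W(A)` of `K(A) = ∂_μD_μ` for an arbitrary cut-off field `A`, `K_W(A) = Δ_W − λ·X_W(A)` PROVED, the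
# exponent identified with the window norm of `∂_μA_μ^γ`, and (II.20) in the finite-dimensional reading PROVED for
# every `A`, every finite ghost window, and all but finitely many couplings `λ` (in particular all small `λ`) — on all
# window coordinates and, for windows closed under `p ↦ −p`, on the independent coordinates of a REAL ghost field,
# with `K(A)` PROVED to map real fields to real fields for a real cut-off `A`, and — EDITION v1.1 — for such `A`
# `det K_W(A) = (det K^rep_W(A))² ≥ 0`, so the display holds with the SIGNED determinant «det[K(A)]» exactly as printed

statement-level skeleton of a published display with citation tags; bookkeeping proved; nothing here is a claim
about the Yang–Mills mass gap, about continuum Yang–Mills on `T⁴` without infrared cutoff, or about the Clay problem —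
and nothing of Magnen–Rivasseau–Sénéor's analysis (expansions, bounds, limits) is asserted or formalised

**Citation header (reproduction of PUBLISHED work).** J. Magnen, V. Rivasseau, R. Sénéor, *Construction of YM₄ with
an infrared cutoff*, Commun. Math. Phys. **155** (1993) 325–383 [MagnenRivasseauSeneor1993], §II.A p.333 tl.27–46 and
footnote 3 (tl.47–49): display (II.20) (tl.29) and the paragraph after it. Loci `p.NNN tl.nn` = journal page / text-layer
line of the held scan `paper:magnen1993-cmp155-mrs-ym4-infrared-cutoff` (PDF page = journal page − 324); the passage
was read on the decoded page IMAGE (render of record `run/shared/lean/pub/lit-balaban/inprint/lit-balaban-p14/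
renders-cmp155/p09_full_s6.png`; 2× crops `p09_crop_r2950-3750_s2.png` (gen 19, display (II.20)) and
`p09_crop_r3700-5000_s2.png`, `p09_crop_r5000-5705_s2.png` (this generation: tl.33–46 and footnote 3) in the seat
folder `run/shared/lean/pub/pub-balaban-gaps/pub-balaban-gaps-mrs-lit-1/g19/renders/`, `…/g20/renders/`). Cell
pub-balaban-gaps, track G3 («MRS 1993 typed AS PRINTED»), seat mrs-lit-1 (gen 20; edition v1.1 gen 20); companion prose
`run/shared/lean/pub/pub-balaban-gaps/g3/MRS-AS-PRINTED.md` §2, §5. Builds on `…MRS93FaddeevPopovUnity` (gen 19: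
`fpIntegral`, `fp_unity`, `fpOpCoeff` = `K(A)` in momentum space with `fpOpCoeff_eq` = «`K(A) = ∂² − λ∂_μ[A_μ,·]`»,
`divCoeff`, `laplaceWindow` = `Δ_W`, `det_laplaceWindow_ne_zero`, `fp_unity_smallCoupling` for an ABSTRACT first-order
matrix `X`) and on `…MRS93GhostReintegrationWindow` (gen 12: the ghost window `ghostWindow Sγ`, the linear read-out `gcoeffW` of
`γ̃` from its real window coordinates, `realifyWindow_add/smul`; through it gen 6's `…MRS93WindowGaussian`:
`realifyWindow`, and gen 2's `rep`/`sgn`).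

**EDITION v1.1 (gen 20, same day) — APPEND-ONLY: + §8.** Every v1 declaration (p398293 ✓ ACCEPTED commit f1f330dbc1a0)
is byte-identical; no import change. New: §8 — for a REAL cut-off field on a window closed under `p ↦ −p`, the window
coordinates split as (real fields) ⊕ i·(real fields) (`realEquiv`), `K_W(A)` acts on the two summands as two copies of
`K^rep_W(A)` (`fpWindow_mulVec_realPair`), hence **`det K_W(A) = (det K^rep_W(A))²`** (`det_fpWindow_eq_sq`, via Mathlib's
`LinearMap.det_conj` and `LinearMap.det_prodMap`) and (II.20) holds with the SIGNED determinant «det[K(A)]» as printed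
(`fp_unity_signed_window_of_det_ne_zero` / `_cofinite` / `fp_unity_signed_window`): gen 19's as-printed precision (ad)
(«det» without bars, where (II.77) prints «det|·|») is ADJUDICATED in this case — harmless, the determinant is a square.

**Why this file.** Gen 19 typed (II.20) in the finite-dimensional reading for an arbitrary invertible real matrix `K`,
identified `K(A) = ∂_μD_μ` as an operator on jets and on momentum-space coefficient functions, and made every symbol
concrete only at `A = 0` (`K(0) = Δ`, invertible because the zero mode is deleted); for `A ≠ 0` it proved the unity for
`Δ_W − λX` with `X` an abstract matrix, leaving «the real window matrix of `K(A)` for `A ≠ 0` (then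
`fp_unity_smallCoupling` applies verbatim)» as the one open item of its successor list. This leaf supplies exactly that
matrix and closes the item: (II.20) now has every symbol concrete for EVERY cut-off field `A`.

**What the paper prints (verbatim, from the page image).** p.333 tl.27–34: *«The formal formula for passing from the
axial gauge to the homothetic gauge is obtained by writing*
*1 = det[K(A)] ∫ dγ e^{−(ζ/2)(∂_μ A_μ^{γ,∞})²}, (II.20)*
*where the determinant is the usual determinant of the Fadeev-Popov operator K(A) = ∂_μD_μ, with D_μ as in (II.5)
(see [IZ]). This formula in itself cannot contain any new information. But we will use an approximation to (II.20)
which amounts no longer to insert 1 but to insert cutoffs, hence there is no contradiction.»* tl.35–46: *«Remark that we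
have written (II.20) in terms of an integration variable γ which lies in the Lie algebra rather than in the Lie group.
Indeed it will be easier for us to give a well defined analogue of this functional integration on a flat Lie algebra
variable, using standard techniques of constructive field theory such as Gaussian measures perturbed by polynomial
interactions. First we will modify (II.20) by using an approximate gauge transformation A^{γ,2} instead of A^{γ,∞} ³.
Also a well defined Gaussian measure with cutoff will be used on γ together with a polynomial which ensures that γ is
small compared to λ^{−1} (so that small fields after gauge transformations remain small) but large compared to
λ^{−1/2} (so that for small fields the formula performs its usual job of integrating out gauge degrees of freedom and
changing the gauge at the price of a Fadeev-Popov determinant).»* Footnote 3 (tl.47–49): *«In fact to have correct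
renormalization group flows to third order in later sections we have to be more cautious and would need something like
A^{γ,10}. But the corresponding formulas are just more complicated and the use of A^{γ,2} should make clear how they
work in a more general case»*. With (II.5) p.329 tl.10–11 *«(A^γ)_μ = A_μ + D_μγ, (II.5) where D = ∂ − λ[A,·] is the
covariant derivative»*, p.329 tl.14–15 *«we want to keep all terms not small as λ → 0»*, and §II.A p.328 tl.13–15
*«the constant fields or the zero mode in Fourier space is deleted in all our functional integrals»*.

**What is typed here (definitions with bodies; bookkeeping kernel-checked, zero `sorry`, zero named facts).**
* §1 **Window coordinates of a coefficient function.** `reImOf`/`reImCoord Sγ F` = the real vector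
  `(p, a, Re/Im) ↦ Re/Im F̃^a(p)` on the ghost window over `Sγ` — the inverse of gen 12's read-out: **`reImCoord_gcoeffW`**
  (`reImCoord (γ̃(x)) = x`), `gcoeffW_apply_mem`, additivity/homogeneity, and **`reImCoord_dotProduct_self`**
  (`‖reImCoord F‖² = Σ_{p∈Sγ}Σ_a |F̃^a(p)|²`).
* §2 **The window compression of an operator and its matrix.** For an additive, `ℝ`-homogeneous `L : GCoeff → GCoeff`:
  `windowOp Sγ L` = the `ℝ`-linear endomorphism `x ↦ reImCoord (L(γ̃(x)))` of the window coordinates, **`windowMatrix Sγ L`**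
  = its real square matrix (Mathlib `LinearMap.toMatrix'`), `windowMatrix_mulVec` (the matrix IS the operator on the
  window), `windowMatrix_eq_of_mulVec`, **`windowMatrix_laplaceCoeff`** (the window matrix of the free Laplacian `∂²` IS
  gen 19's `laplaceWindow = diag(−|p|²)`), `windowMatrix_sub_smul` (linearity in `L`).
* §3 **The Faddeev–Popov window matrix.** `fpFirstOrder T A` = the operator `∂_μ[A_μ, ·]` (first-order part of `K(A)`,
  `fpOpCoeff_eq_laplace_sub`), **`fpWindow Sγ T λ A`** = `K_W(A)` := the window matrix of gen 19's `fpOpCoeff T λ A` = `K(A)`,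
  `fpFirstOrderWindow Sγ T A` = `X_W(A)`; PROVED **`fpWindow_mulVec`** (`K_W(A)·x = reImCoord (K(A)γ̃(x))`),
  **`fpWindow_eq`** (`K_W(A) = Δ_W − λ·X_W(A)`), `fpWindow_zero_coupling`/`fpFirstOrderWindow_zero_field`/`fpWindow_zero_field`
  (gen 19's §4 is the case `A = 0`), `continuous_det_fpWindow`, **`det_fpWindow_eventually_ne_zero`** (invertible for all
  small `λ`: `det Δ_W ≠ 0` by the deleted zero mode + continuity), `fp_unity_fpWindow_of_det_ne_zero`, **`fp_unity_fpWindow`**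
  ((II.20) in READING (FD) for `K = K_W(A)`, every source window `b`, all small `λ` — gen 19's `fp_unity_smallCoupling`
  with its abstract `X` INSTANTIATED to `X_W(A)`).
* §4 **The exponent.** `divWindow Sγ A` = the window of `(∂·A)~`, `gaugeInfCoeff T λ A G` = `A^γ = A + Dγ` (II.5) as a
  coefficient function, `divCoeff_gaugeInfCoeff` (`∂·A^γ = ∂·A + K(A)γ`), **`reImCoord_div_gaugeInfCoeff`**
  (`reImCoord (∂·A^{γ̃(x)}) = K_W(A)·x + b`: the exponent's argument IS the affine image of gen 19's `fpIntegral`),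
  **`fpExponent_eq`** (`|K_W(A)x + b|² = Σ_{p∈Sγ}Σ_a |(∂_μA_μ^{γ̃(x)})~^a(p)|²`), **`fpIntegral_fpWindow_eq`**, and the display
  with the printed exponent: **`fp_unity_window_of_det_ne_zero`**, **`fp_unity_window`**
  (`|det K_W(A)|·(ζ/2π)^{|W|/2}·∫dγ e^{−(ζ/2)Σ_{p∈Sγ}Σ_a|(∂_μA_μ^γ)~^a(p)|²} = 1` for all small `λ`),
  `integral_mul_fp_unity_window` («cannot contain any new information»: inserting it under any `∫F(A)dμ(A)` changes nothing).
* §5 **All but finitely many couplings.** `detPoly W X` = `det(Δ_W − t·X) ∈ ℝ[t]`, `eval_detPoly`, `detPoly_ne_zero`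
  (value `det Δ_W ≠ 0` at `t = 0`), `finite_setOf_det_laplaceWindow_sub_smul_eq_zero`, **`finite_setOf_det_fpWindow_eq_zero`**
  (`K_W(A)` is singular for only finitely many `λ`), `det_fpWindow_ne_zero_cofinite`, **`fp_unity_window_cofinite`**
  ((II.20) on the window for all `λ` outside a finite set depending on `A` and the window).
* §6 **The reality-constrained coordinates.** For a momentum window closed under `p ↦ −p` (`hS`), the same construction
  on the INDEPENDENT coordinates of a real ghost field — gen 6's representatives `rep` (positive momenta), realified to the
  whole window by `realifyWindow` (the modes at `−p` are the `±` copies, `γ̃(−p) = conj γ̃(p)`): `repWindow`, `reImCoordRep`,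
  `windowOpRep`/**`windowMatrixRep`**, `windowMatrixRep_mulVec`, `isPos_of_mem_repWindow`, `rep_eq_self_of_mem_repWindow`,
  `repWindow_subset`, `realifyWindow_apply_rep`, **`windowMatrixRep_laplaceCoeff`** (again `diag(−|p|²)`),
  `windowMatrixRep_sub_smul`, **`fpWindowRep`** = `K^rep_W(A)`, `fpFirstOrderWindowRep`, **`fpWindowRep_eq`**
  (`K^rep_W(A) = Δ^rep_W − λ·X^rep_W(A)`), `finite_setOf_det_fpWindowRep_eq_zero`, **`fp_unity_fpWindowRep_cofinite`**,
  **`fp_unity_fpWindowRep`** ((II.20) in READING (FD) on the independent real coordinates, all but finitely many / all small `λ`).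
* §7 **Reality.** `IsRealCoeff`/`IsRealVCoeff` (`F̃(−k) = conj F̃(k)`); reality is preserved by `∂_μ` (`isRealCoeff_dCoeff`), by
  the wedge-product convolution over a set closed under `k ↦ −k` (`cross_conj`, `isRealCoeff_convCross`), by `∂²`, by
  `∂_μ[A_μ,·]` for real `A` (`isRealCoeff_fpFirstOrder`), hence **`isRealCoeff_fpOpCoeff`: `K(A)` maps real ghost fields
  to real ones for a real cut-off `A`**; the read-out of realified coordinates is real (`isRealCoeff_gcoeffW_realifyWindow`,
  the ghost twin of gen 5's `coeff_realify_neg`), `reImOf_eq_sgn_mul_rep`, and **`fpWindow_mulVec_realifyWindow`: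
  `K_W(A)·R(y) = R(K^rep_W(A)·y)`** with `R = realifyWindow` — the window matrix of §3 intertwines gen 6's realification
  with §6's representative matrix, so on a window closed under `p ↦ −p` NOTHING of `K(A)γ` is lost by reading the
  independent coordinates of a real `γ`.
* §8 (v1.1) **The signed determinant.** `flipMode`, **`iMul`** (multiplication by `i` on window coordinates; `gcoeffW_iMul`,
  `reImCoord_I_smul`), **`fpWindow_mulVec_iMul`** (`K_W(A)` commutes with `i`: `K(A)` is `ℂ`-linear, `fpOpCoeff_smul_fun`);
  `repIn`, `partner` (the mode `(−p, a, b)` of a representative `(p, a, b)`), `realifyWindow_apply_partner` (`+y` for a real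
  part, `−y` for an imaginary part), `mem_repWindow_iff`, `flipRep`, `flipRep_flipRep`, `flipMode_repIn`, `flipMode_partner`;
  **`realPair`** `Φ(y₁,y₂) = R(y₁) + i·R(y₂)` with its explicit inverse `realPart1`/`realPart2` (`Re G₁(p) = (Re γ̃(p) + Re γ̃(−p))/2`,
  …), `realPair_apply_repIn`/`_partner`, `realPair_add`/`_smul`, `realPart1_realPair`, `realPart2_realPair`,
  `eq_repIn_or_partner` (every mode is a representative or a partner), `realPair_realPart`, packaged as the linear
  isomorphism **`realEquiv`** `((rep W → ℝ) × (rep W → ℝ)) ≃ₗ[ℝ] (W → ℝ)`; **`fpWindow_mulVec_realPair`**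
  (`K_W(A)·Φ(y₁,y₂) = Φ(K^rep_W(A)y₁, K^rep_W(A)y₂)` for real `A`), `toLin'_fpWindow_eq_conj`
  (`K_W(A) = Φ ∘ (K^rep_W(A) × K^rep_W(A)) ∘ Φ⁻¹`), **`det_fpWindow_eq_sq`** (`det K_W(A) = (det K^rep_W(A))²`),
  `det_fpWindow_nonneg`, `abs_det_fpWindow`, and (II.20) with the SIGNED determinant:
  **`fp_unity_signed_window_of_det_ne_zero`**, **`fp_unity_signed_window_cofinite`**, `fp_unity_signed_window`.

**Readings (declared).** (FD) FINITE-DIMENSIONAL (as in gen 19 and `…MRS93GhostReintegration`): «det» is the determinant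
of the window matrix and «∫dγ» Lebesgue measure on finitely many real coordinates of `γ` — in §§2–5 ALL modes
`(p, a, Re/Im)`, `p ∈ Sγ`, as independent coordinates (exactly as gen 19's §4 treats an arbitrary `W : Finset GhostMode`),
in §6 the INDEPENDENT coordinates of a real `γ` (gen 6's representatives, the window closed under `p ↦ −p`), the two
related by §7 (`K(A)` maps real fields to real fields for a real cut-off `A`; `K_W(A)·R = R·K^rep_W(A)`) and §8 (the
window coordinates ARE (real fields) ⊕ i·(real fields), `realEquiv`; `det K_W(A) = (det K^rep_W(A))²`). (P) momentum space, `∂_μ ↔ ip_μ` (the tree's `dCoeff`); the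
window sum `Σ_{p∈Sγ}Σ_a|F̃^a(p)|²` is the Parseval form of `∫_Λ|F|²` restricted to the window (the position-space
dictionary is gen 9's `…MRS93PositionSpaceFields`, not imported). (LIN) as in gen 19: the exponent is read for the
FIRST-ORDER transformation (II.5), `A^γ = A + Dγ`, under which `∂·A^γ` is affine in `γ`; for `A^{γ,2}`/`A^{γ,∞}` gen 19's
`divCoeff_gaugeTrunc2` exhibits the quadratic defect and (II.20) is the print's «formal formula». (W) WINDOW COMPRESSION:
`K_W(A)` is the compression `P_W K(A) P_W` — `γ̃(x)` vanishes outside `Sγ` (gen 12's `gcoeffW`) and the result is read on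
`Sγ`; products of cut-off fields are cut off at `{0} ∪ T` as in gen 5's `covDCoeff` (its READING (Z)).

**What is NOT claimed.** That (II.20) holds as an identity of functional integrals or for `A^{γ,∞}`; any statement
uniform in the window or as `ρ → ∞`; invertibility of `K_W(A)` at a GIVEN coupling (only: at all but finitely many, and
all sufficiently small, `λ` — Gribov-type degeneracies at finite `λ` are exactly the excluded finite set, about which
nothing further is said); the sign of `det K^rep_W(A)` itself, or anything for a NON-real `A` or a window not closed
under `p ↦ −p` beyond §§2–5; anything of MRS's expansion or of the
homothetic-gauge construction (II.36)–(II.40) the display motivates (typed in `…MRS93BackgroundGaugeFixing`); cell tally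
untouched (0/13 theorems, 0/9 spine estimates, 0/6 binders); NOT continuum Yang–Mills on `T⁴` without infrared cutoff,
NOT mass gap, NOT Clay, nothing of Bałaban's.
-/

noncomputable section

open MeasureTheory Finset
open scoped Matrix

namespace Literature.MathematicalPhysics.QuantumFieldTheory.MagnenRivasseauSeneor1993

namespace FaddeevPopovUnity

open MainStatement MainStatement.GhostGaussian MainStatement.GhostWindow SectIV TruncatedGauge InfinitesimalGauge

/-! ## §1 Reading a ghost-type coefficient function back into the real window coordinates -/

/-- The real coordinate of a ghost-type coefficient function `F` at a ghost mode: at `(p, a, Re)` the value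
`Re F̃^a(p)`, at `(p, a, Im)` the value `Im F̃^a(p)` — the inverse bookkeeping of gen 12's read-out `gcoeffW`
(`γ̃^a(k) = x(k,a,Re) + i·x(k,a,Im)`). [cite: MagnenRivasseauSeneor1993, (II.20) p.333 tl.29, tl.35–37; §II.A p.328 tl.12–17] -/
def reImOf (F : GCoeff) (m : GhostMode) : ℝ := if m.2.2 then (F m.1.1 m.2.1).im else (F m.1.1 m.2.1).re

/-- The same on the ghost window over `Sγ` (all modes `(p, a, Re/Im)` with `p ∈ Sγ`), as a real coordinate vector.
[cite: MagnenRivasseauSeneor1993, (II.20) p.333 tl.29, tl.35–37; §II.A p.328 tl.12–17] -/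
def reImCoord (Sγ : Finset Momentum) (F : GCoeff) : ghostWindow Sγ → ℝ := fun m => reImOf F m.1

/-- `reImCoord` unfolded. [cite: MagnenRivasseauSeneor1993, §II.A p.328 tl.12–17] -/
theorem reImCoord_apply (Sγ : Finset Momentum) (F : GCoeff) (m : ghostWindow Sγ) :
    reImCoord Sγ F m = if m.1.2.2 then (F m.1.1.1 m.1.2.1).im else (F m.1.1.1 m.1.2.1).re := rfl

/-- `reImCoord` is additive … [cite: MagnenRivasseauSeneor1993, §II.A p.328 tl.12–17] -/
theorem reImCoord_add (Sγ : Finset Momentum) (F G : GCoeff) :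
    reImCoord Sγ (F + G) = reImCoord Sγ F + reImCoord Sγ G := by
  funext m
  rcases m with ⟨⟨p, a, b⟩, hm⟩
  cases b <;> simp [reImCoord, reImOf]

/-- … `ℝ`-homogeneous … [cite: MagnenRivasseauSeneor1993, §II.A p.328 tl.12–17] -/
theorem reImCoord_smul (Sγ : Finset Momentum) (r : ℝ) (F : GCoeff) :
    reImCoord Sγ (r • F) = r • reImCoord Sγ F := by
  funext m
  rcases m with ⟨⟨p, a, b⟩, hm⟩
  cases b <;> simp [reImCoord, reImOf]

/-- … and compatible with subtraction of a complex-real multiple: `reImCoord (F − λ·G) = reImCoord F − λ·reImCoord G`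
for REAL `λ`. [cite: MagnenRivasseauSeneor1993, §II.A p.328 tl.12–17] -/
theorem reImCoord_sub_smul (Sγ : Finset Momentum) (lam : ℝ) (F G : GCoeff) :
    reImCoord Sγ (fun k => F k - (lam : ℂ) • G k) = reImCoord Sγ F - lam • reImCoord Sγ G := by
  funext m
  rcases m with ⟨⟨p, a, b⟩, hm⟩
  cases b <;> simp [reImCoord, reImOf]

/-- The read-out `γ̃ = gcoeffW Sγ x` evaluated at a momentum OF the window: `γ̃^a(p) = x(p,a,Re) + i·x(p,a,Im)`.
[cite: MagnenRivasseauSeneor1993, (II.36) p.339 tl.22–27; §II.A p.328 tl.12–15] -/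
theorem gcoeffW_apply_mem (Sγ : Finset Momentum) (x : ghostWindow Sγ → ℝ) (p : Momentum) (hp : p ∈ Sγ)
    (a : Fin 3) :
    gcoeffW Sγ x p.1 a = (x (windowMode p hp a false) : ℂ) + (x (windowMode p hp a true) : ℂ) * Complex.I := by
  unfold gcoeffW
  rw [dif_neg p.2]
  simp only [Subtype.coe_eta, dif_pos hp]

/-- **Reading back the read-out is the identity**: `reImCoord (γ̃(x)) = x`. [cite: MagnenRivasseauSeneor1993, (II.36) p.339 tl.22–27; §II.A p.328 tl.12–17] -/
theorem reImCoord_gcoeffW (Sγ : Finset Momentum) (x : ghostWindow Sγ → ℝ) :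
    reImCoord Sγ (gcoeffW Sγ x) = x := by
  funext m
  rcases m with ⟨⟨p, a, b⟩, hm⟩
  have hp : p ∈ Sγ := mem_ghostWindow.mp hm
  have h := gcoeffW_apply_mem Sγ x p hp a
  cases b
  · simp only [reImCoord, reImOf, Bool.false_eq_true, ↓reduceIte, h, Complex.add_re, Complex.ofReal_re,
      Complex.mul_re, Complex.I_re, Complex.ofReal_im, Complex.I_im, mul_zero, mul_one, sub_zero, add_zero]
    rfl
  · simp only [reImCoord, reImOf, ↓reduceIte, h, Complex.add_im, Complex.ofReal_im, Complex.mul_im, Complex.I_re,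
      Complex.ofReal_re, Complex.I_im, mul_zero, mul_one, zero_add, add_zero]
    rfl

/-- `‖reImCoord F‖² = Σ_{p∈Sγ} Σ_a |F̃^a(p)|²` — the squared Euclidean norm of the real window coordinates is the
window `ℓ²`-norm of the complex coefficients (`|z|² = (Re z)² + (Im z)²`). [cite: MagnenRivasseauSeneor1993, §II.A p.328 tl.37–42; (II.20) p.333 tl.29] -/
theorem reImCoord_dotProduct_self (Sγ : Finset Momentum) (F : GCoeff) :
    reImCoord Sγ F ⬝ᵥ reImCoord Sγ F = ∑ p ∈ Sγ, ∑ a : Fin 3, Complex.normSq (F p.1 a) := by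
  unfold dotProduct reImCoord
  rw [Finset.sum_coe_sort (ghostWindow Sγ) (fun m : GhostMode => reImOf F m * reImOf F m), ghostWindow,
    Finset.sum_product]
  refine Finset.sum_congr rfl fun p _ => ?_
  rw [← Finset.univ_product_univ, Finset.sum_product]
  refine Finset.sum_congr rfl fun a _ => ?_
  simp only [Fintype.sum_bool, reImOf, ↓reduceIte, Bool.false_eq_true, Complex.normSq_apply]
  ring

/-! ## §2 An additive, `ℝ`-homogeneous operator on coefficient functions, COMPRESSED TO THE WINDOW: the
`ℝ`-linear endomorphism `x ↦ reImCoord (L(γ̃(x)))` of the window coordinates and its (square, real) matrix -/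

/-- **The window compression of an operator `L` on ghost coefficient functions**: read the window coordinates `x` out as
the cut-off coefficient function `γ̃(x)` (zero outside `Sγ`), apply `L`, read the result back on the same window —
an `ℝ`-LINEAR endomorphism of `ghostWindow Sγ → ℝ` when `L` is additive and `ℝ`-homogeneous (READING (FD): «det» and
«∫dγ» of (II.20) refer to finitely many real coordinates of `γ`). [cite: MagnenRivasseauSeneor1993, (II.20) p.333 tl.29–37] -/
def windowOp (Sγ : Finset Momentum) (L : GCoeff → GCoeff)
    (hadd : ∀ η₁ η₂, L (η₁ + η₂) = L η₁ + L η₂) (hsmul : ∀ (r : ℝ) η, L (r • η) = r • L η) :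
    (ghostWindow Sγ → ℝ) →ₗ[ℝ] (ghostWindow Sγ → ℝ) where
  toFun x := reImCoord Sγ (L (gcoeffW Sγ x))
  map_add' x₁ x₂ := by rw [gcoeffW_add, hadd, reImCoord_add]
  map_smul' r x := by rw [gcoeffW_smul, hsmul, reImCoord_smul]; rfl

/-- The window compression evaluated. [cite: MagnenRivasseauSeneor1993, (II.20) p.333 tl.29–37] -/
theorem windowOp_apply (Sγ : Finset Momentum) (L : GCoeff → GCoeff)
    (hadd : ∀ η₁ η₂, L (η₁ + η₂) = L η₁ + L η₂) (hsmul : ∀ (r : ℝ) η, L (r • η) = r • L η)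
    (x : ghostWindow Sγ → ℝ) : windowOp Sγ L hadd hsmul x = reImCoord Sγ (L (gcoeffW Sγ x)) := rfl

/-- **THE WINDOW MATRIX of `L`**: the real square matrix, indexed by the modes of the window, of the compression
`windowOp` (Mathlib `LinearMap.toMatrix'` in the coordinate basis) — the object whose `det` (II.20) takes in READING (FD).
[cite: MagnenRivasseauSeneor1993, (II.20) p.333 tl.29–31] -/
def windowMatrix (Sγ : Finset Momentum) (L : GCoeff → GCoeff)
    (hadd : ∀ η₁ η₂, L (η₁ + η₂) = L η₁ + L η₂) (hsmul : ∀ (r : ℝ) η, L (r • η) = r • L η) :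
    Matrix (ghostWindow Sγ) (ghostWindow Sγ) ℝ :=
  LinearMap.toMatrix' (windowOp Sγ L hadd hsmul)

/-- **The window matrix IS the operator on the window**: `M_L · x = reImCoord (L(γ̃(x)))`.
[cite: MagnenRivasseauSeneor1993, (II.20) p.333 tl.29–37] -/
theorem windowMatrix_mulVec (Sγ : Finset Momentum) (L : GCoeff → GCoeff)
    (hadd : ∀ η₁ η₂, L (η₁ + η₂) = L η₁ + L η₂) (hsmul : ∀ (r : ℝ) η, L (r • η) = r • L η)
    (x : ghostWindow Sγ → ℝ) : windowMatrix Sγ L hadd hsmul *ᵥ x = reImCoord Sγ (L (gcoeffW Sγ x)) := by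
  rw [windowMatrix, LinearMap.toMatrix'_mulVec]
  rfl

/-- A window matrix is determined by its action: if `reImCoord (L(γ̃(x))) = M · x` for every `x`, then `M_L = M`.
[cite: MagnenRivasseauSeneor1993, (II.20) p.333 tl.29–31] -/
theorem windowMatrix_eq_of_mulVec (Sγ : Finset Momentum) (L : GCoeff → GCoeff)
    (hadd : ∀ η₁ η₂, L (η₁ + η₂) = L η₁ + L η₂) (hsmul : ∀ (r : ℝ) η, L (r • η) = r • L η)
    {M : Matrix (ghostWindow Sγ) (ghostWindow Sγ) ℝ} (h : ∀ x, reImCoord Sγ (L (gcoeffW Sγ x)) = M *ᵥ x) :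
    windowMatrix Sγ L hadd hsmul = M := by
  rw [← LinearMap.toMatrix'_toLin' M, windowMatrix]
  congr 1
  refine LinearMap.ext fun x => ?_
  rw [windowOp_apply, Matrix.toLin'_apply, h x]

/-- The Laplacian `∂²` is additive on coefficient functions (gen 5's `laplaceCoeff_add`, as functions).
[cite: MagnenRivasseauSeneor1993, (II.68) p.344 tl.19; (II.20) p.333 tl.30–31] -/
theorem laplaceCoeff_add_fun (η₁ η₂ : GCoeff) : laplaceCoeff (η₁ + η₂) = laplaceCoeff η₁ + laplaceCoeff η₂ :=
  funext fun k => laplaceCoeff_add η₁ η₂ k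

/-- A real multiple of a coefficient function is the complex multiple by the real number viewed in `ℂ`.
[cite: MagnenRivasseauSeneor1993, §II.A p.328 tl.12–17] -/
theorem real_smul_eq_coe_smul (r : ℝ) (η : GCoeff) : (r • η : GCoeff) = ((r : ℂ) • η) := by
  funext k a
  simp [Complex.real_smul]

/-- … and conversely for a ghost-type value vector. [cite: MagnenRivasseauSeneor1993, §II.A p.328 tl.12–17] -/
theorem coe_smul_eq_real_smul (r : ℝ) (v : Fin 3 → ℂ) : ((r : ℂ) • v) = r • v := by
  funext a
  simp [Complex.real_smul]

/-- The Laplacian `∂²` is `ℝ`-homogeneous (gen 5's `laplaceCoeff_smul` at a real scalar).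
[cite: MagnenRivasseauSeneor1993, (II.68) p.344 tl.19; (II.20) p.333 tl.30–31] -/
theorem laplaceCoeff_real_smul (r : ℝ) (η : GCoeff) : laplaceCoeff (r • η) = r • laplaceCoeff η := by
  funext k
  rw [real_smul_eq_coe_smul, laplaceCoeff_smul, Pi.smul_apply, coe_smul_eq_real_smul]

/-- **THE WINDOW MATRIX OF THE FREE LAPLACIAN `K(0) = ∂²` IS gen 19's `laplaceWindow` — `diag(−|p|²)` on the modes of
the window** (`(∂²γ̃)^a(p) = −|p|²γ̃^a(p)`, real and imaginary parts alike). [cite: MagnenRivasseauSeneor1993, (II.20) p.333 tl.29–31; §II.A p.328 tl.12–15] -/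
theorem windowMatrix_laplaceCoeff (Sγ : Finset Momentum) :
    windowMatrix Sγ laplaceCoeff laplaceCoeff_add_fun laplaceCoeff_real_smul = laplaceWindow (ghostWindow Sγ) := by
  refine windowMatrix_eq_of_mulVec Sγ laplaceCoeff laplaceCoeff_add_fun laplaceCoeff_real_smul fun x => ?_
  funext m
  rw [laplaceWindow_mulVec]
  rcases m with ⟨⟨p, a, b⟩, hm⟩
  have hp : p ∈ Sγ := mem_ghostWindow.mp hm
  have h := gcoeffW_apply_mem Sγ x p hp a
  have hx := congrFun (reImCoord_gcoeffW Sγ x) ⟨(p, a, b), hm⟩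
  simp only [reImCoord, reImOf] at hx ⊢
  rw [laplaceCoeff_eq_laplaceSymbol_mul (gcoeffW Sγ x) p a]
  cases b
  · simp only [Bool.false_eq_true, ↓reduceIte, Complex.re_ofReal_mul] at hx ⊢
    rw [hx]
  · simp only [↓reduceIte, Complex.im_ofReal_mul] at hx ⊢
    rw [hx]

/-- **Window matrices are linear in the operator**: if `L = L₁ − λ·L₂` pointwise (real `λ`), then
`M_L = M_{L₁} − λ·M_{L₂}`. [cite: MagnenRivasseauSeneor1993, (II.20) p.333 tl.29–31] -/
theorem windowMatrix_sub_smul (Sγ : Finset Momentum) (lam : ℝ) (L L₁ L₂ : GCoeff → GCoeff)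
    (hadd : ∀ η₁ η₂, L (η₁ + η₂) = L η₁ + L η₂) (hsmul : ∀ (r : ℝ) η, L (r • η) = r • L η)
    (hadd₁ : ∀ η₁ η₂, L₁ (η₁ + η₂) = L₁ η₁ + L₁ η₂) (hsmul₁ : ∀ (r : ℝ) η, L₁ (r • η) = r • L₁ η)
    (hadd₂ : ∀ η₁ η₂, L₂ (η₁ + η₂) = L₂ η₁ + L₂ η₂) (hsmul₂ : ∀ (r : ℝ) η, L₂ (r • η) = r • L₂ η)
    (hL : ∀ η k, L η k = L₁ η k - (lam : ℂ) • L₂ η k) :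
    windowMatrix Sγ L hadd hsmul = windowMatrix Sγ L₁ hadd₁ hsmul₁ - lam • windowMatrix Sγ L₂ hadd₂ hsmul₂ := by
  refine windowMatrix_eq_of_mulVec Sγ L hadd hsmul fun x => ?_
  rw [Matrix.sub_mulVec, Matrix.smul_mulVec, windowMatrix_mulVec, windowMatrix_mulVec,
    ← reImCoord_sub_smul]
  congr 1
  funext k
  exact hL (gcoeffW Sγ x) k

/-! ## §3 The Faddeev–Popov window matrix `K_W(A) = Δ_W − λ·X_W(A)` for a cut-off field `A` -/

/-- The FIRST-ORDER PART `∂_μ[A_μ, ·]` of `K(A) = ∂² − λ∂_μ[A_μ, ·]` as an operator on ghost coefficient functions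
(`Σ_μ ik_μ Σ_{q+r=k} Ã_μ(q) ×₃ η̃(r)`, gen 19's `fpOpCoeff_eq`; the cut-off field `A` given by its coefficient function,
products cut off at `{0} ∪ T` as in gen 5's `covDCoeff`). [cite: MagnenRivasseauSeneor1993, (II.20) p.333 tl.30–31; (II.5) p.329 tl.10–11] -/
def fpFirstOrder (T : Finset (Fin 4 → ℤ)) (A : VCoeff) : GCoeff → GCoeff :=
  fun η k => ∑ μ, dCoeff (fun k' => convCross (insert 0 T) (fun q => A q μ) η k') μ k

/-- `∂_μ[A_μ, ·]` is additive … [cite: MagnenRivasseauSeneor1993, (II.20) p.333 tl.30–37] -/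
theorem fpFirstOrder_add (T : Finset (Fin 4 → ℤ)) (A : VCoeff) (η₁ η₂ : GCoeff) :
    fpFirstOrder T A (η₁ + η₂) = fpFirstOrder T A η₁ + fpFirstOrder T A η₂ := by
  funext k
  simp only [fpFirstOrder, Pi.add_apply, uOpA_add, Finset.sum_add_distrib]

/-- … and `ℝ`-homogeneous. [cite: MagnenRivasseauSeneor1993, (II.20) p.333 tl.30–37] -/
theorem fpFirstOrder_smul (T : Finset (Fin 4 → ℤ)) (A : VCoeff) (r : ℝ) (η : GCoeff) :
    fpFirstOrder T A (r • η) = r • fpFirstOrder T A η := by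
  funext k
  rw [real_smul_eq_coe_smul]
  simp only [fpFirstOrder, Pi.smul_apply, uOpA_smul, ← Finset.smul_sum]
  exact coe_smul_eq_real_smul r _

/-- `K(A)` as an operator `GCoeff → GCoeff` is additive (gen 19's `fpOpCoeff_add`, as functions).
[cite: MagnenRivasseauSeneor1993, (II.20) p.333 tl.30–37] -/
theorem fpOpCoeff_add_fun (T : Finset (Fin 4 → ℤ)) (lam : ℝ) (A : VCoeff) (η₁ η₂ : GCoeff) :
    fpOpCoeff T lam A (η₁ + η₂) = fpOpCoeff T lam A η₁ + fpOpCoeff T lam A η₂ :=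
  funext fun k => fpOpCoeff_add T lam A η₁ η₂ k

/-- … and `ℝ`-homogeneous (gen 19's `fpOpCoeff_smul` at a real scalar). [cite: MagnenRivasseauSeneor1993, (II.20) p.333 tl.30–37] -/
theorem fpOpCoeff_real_smul (T : Finset (Fin 4 → ℤ)) (lam : ℝ) (A : VCoeff) (r : ℝ) (η : GCoeff) :
    fpOpCoeff T lam A (r • η) = r • fpOpCoeff T lam A η := by
  funext k
  rw [real_smul_eq_coe_smul, fpOpCoeff_smul, Pi.smul_apply, coe_smul_eq_real_smul]

/-- `K(A) = ∂² − λ·∂_μ[A_μ, ·]` pointwise (gen 19's `fpOpCoeff_eq` in the present names).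
[cite: MagnenRivasseauSeneor1993, (II.20) p.333 tl.30–31; (II.5) p.329] -/
theorem fpOpCoeff_eq_laplace_sub (T : Finset (Fin 4 → ℤ)) (lam : ℝ) (A : VCoeff) (η : GCoeff) (k : Fin 4 → ℤ) :
    fpOpCoeff T lam A η k = laplaceCoeff η k - (lam : ℂ) • fpFirstOrder T A η k :=
  fpOpCoeff_eq T lam A η k

/-- **`K_W(A)` — THE WINDOW MATRIX OF THE FADDEEV–POPOV OPERATOR `K(A) = ∂_μD_μ`** for the cut-off field with
coefficient function `A` (products cut off at `{0} ∪ T`), coupling `λ`, on the ghost window over `Sγ`: the real square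
matrix of `x ↦ reImCoord (K(A)γ̃(x))`. This is the `K` of gen 19's `fpIntegral K b ζ` / `fp_unity` for THE operator of
(II.20), not an abstract matrix. [cite: MagnenRivasseauSeneor1993, (II.20) p.333 tl.29–31; (II.5) p.329 tl.10–11] -/
def fpWindow (Sγ : Finset Momentum) (T : Finset (Fin 4 → ℤ)) (lam : ℝ) (A : VCoeff) :
    Matrix (ghostWindow Sγ) (ghostWindow Sγ) ℝ :=
  windowMatrix Sγ (fpOpCoeff T lam A) (fpOpCoeff_add_fun T lam A) (fpOpCoeff_real_smul T lam A)

/-- `X_W(A)` — the window matrix of the first-order part `∂_μ[A_μ, ·]` (independent of `λ`).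
[cite: MagnenRivasseauSeneor1993, (II.20) p.333 tl.30–31; (II.5) p.329 tl.10–11] -/
def fpFirstOrderWindow (Sγ : Finset Momentum) (T : Finset (Fin 4 → ℤ)) (A : VCoeff) :
    Matrix (ghostWindow Sγ) (ghostWindow Sγ) ℝ :=
  windowMatrix Sγ (fpFirstOrder T A) (fpFirstOrder_add T A) (fpFirstOrder_smul T A)

/-- **`K_W(A)` acts as `K(A)` on the window**: `K_W(A)·x = reImCoord (K(A)γ̃(x))`.
[cite: MagnenRivasseauSeneor1993, (II.20) p.333 tl.29–31] -/
theorem fpWindow_mulVec (Sγ : Finset Momentum) (T : Finset (Fin 4 → ℤ)) (lam : ℝ) (A : VCoeff)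
    (x : ghostWindow Sγ → ℝ) : fpWindow Sγ T lam A *ᵥ x = reImCoord Sγ (fpOpCoeff T lam A (gcoeffW Sγ x)) :=
  windowMatrix_mulVec Sγ _ _ _ x

/-- **`K_W(A) = Δ_W − λ·X_W(A)`** — the Faddeev–Popov window matrix is gen 19's free window Laplacian `diag(−|p|²)`
minus `λ` times the (coupling-independent) window matrix of `∂_μ[A_μ, ·]`: EXACTLY the shape `Δ_W − λX` of gen 19's
`fp_unity_smallCoupling`, now with `X = X_W(A)` determined by the field. [cite: MagnenRivasseauSeneor1993, (II.20) p.333 tl.29–31; (II.5) p.329 tl.10–11; p.329 tl.14–15] -/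
theorem fpWindow_eq (Sγ : Finset Momentum) (T : Finset (Fin 4 → ℤ)) (lam : ℝ) (A : VCoeff) :
    fpWindow Sγ T lam A = laplaceWindow (ghostWindow Sγ) - lam • fpFirstOrderWindow Sγ T A := by
  rw [← windowMatrix_laplaceCoeff]
  exact windowMatrix_sub_smul Sγ lam _ _ _ _ _ _ _ _ _ (fpOpCoeff_eq_laplace_sub T lam A)

/-- At zero coupling the Faddeev–Popov window matrix is the free one: `K_W(A)|_{λ=0} = Δ_W`.
[cite: MagnenRivasseauSeneor1993, (II.20) p.333 tl.29–31; p.329 tl.14–15] -/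
theorem fpWindow_zero_coupling (Sγ : Finset Momentum) (T : Finset (Fin 4 → ℤ)) (A : VCoeff) :
    fpWindow Sγ T 0 A = laplaceWindow (ghostWindow Sγ) := by
  rw [fpWindow_eq, zero_smul, sub_zero]

/-- At zero field the first-order window matrix vanishes: `X_W(0) = 0`. [cite: MagnenRivasseauSeneor1993, (II.20) p.333 tl.30–31] -/
theorem fpFirstOrderWindow_zero_field (Sγ : Finset Momentum) (T : Finset (Fin 4 → ℤ)) :
    fpFirstOrderWindow Sγ T 0 = 0 := by
  refine windowMatrix_eq_of_mulVec Sγ _ _ _ fun x => ?_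
  rw [Matrix.zero_mulVec]
  have h0 : fpFirstOrder T 0 (gcoeffW Sγ x) = 0 := by
    funext k
    simp only [fpFirstOrder, Pi.zero_apply]
    refine Finset.sum_eq_zero fun μ _ => ?_
    have : (fun k' => convCross (insert 0 T) (fun _ => (0 : Fin 3 → ℂ)) (gcoeffW Sγ x) k') = fun _ => 0 :=
      funext fun k' => convCross_zero_left (insert 0 T) _ k'
    rw [this]
    ext a
    simp [dCoeff]
  rw [h0]
  funext m
  rcases m with ⟨⟨p, a, b⟩, hm⟩
  cases b <;> simp [reImCoord, reImOf]

/-- … so at zero field `K_W(0) = Δ_W` for every coupling (gen 19's §4 is the case `A = 0` of the present matrix).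
[cite: MagnenRivasseauSeneor1993, (II.20) p.333 tl.29–31; §II.A p.328 tl.13–15] -/
theorem fpWindow_zero_field (Sγ : Finset Momentum) (T : Finset (Fin 4 → ℤ)) (lam : ℝ) :
    fpWindow Sγ T lam 0 = laplaceWindow (ghostWindow Sγ) := by
  rw [fpWindow_eq, fpFirstOrderWindow_zero_field, smul_zero, sub_zero]

/-- `det K_W(A)` is a continuous function of the coupling (a polynomial in `λ`).
[cite: MagnenRivasseauSeneor1993, (II.20) p.333 tl.29; p.329 tl.14–15] -/
theorem continuous_det_fpWindow (Sγ : Finset Momentum) (T : Finset (Fin 4 → ℤ)) (A : VCoeff) :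
    Continuous fun lam : ℝ => (fpWindow Sγ T lam A).det := by
  simp_rw [fpWindow_eq]
  exact (continuous_const.sub (continuous_id.smul continuous_const)).matrix_det

/-- **`K_W(A)` is invertible for all small couplings** — `det K_W(A) ≠ 0` for `λ` in a neighbourhood of `0`, because
`det Δ_W ≠ 0` (the zero mode is deleted, gen 19's `det_laplaceWindow_ne_zero`) and the determinant is continuous in
`λ`; the print's regime is `λ → 0` (p.329 tl.14–15). [cite: MagnenRivasseauSeneor1993, (II.20) p.333 tl.29–31; §II.A p.328 tl.13–15; p.329 tl.14–15] -/
theorem det_fpWindow_eventually_ne_zero (Sγ : Finset Momentum) (T : Finset (Fin 4 → ℤ)) (A : VCoeff) :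
    ∀ᶠ lam in nhds (0 : ℝ), (fpWindow Sγ T lam A).det ≠ 0 := by
  simp_rw [fpWindow_eq]
  exact det_laplaceWindow_sub_smul_eventually_ne_zero (ghostWindow Sγ) (fpFirstOrderWindow Sγ T A)

/-- **(II.20) in READING (FD) FOR THE FADDEEV–POPOV OPERATOR OF THE CUT-OFF FIELD `A`** on the ghost window over `Sγ`,
whenever `K_W(A)` is invertible: `|det K_W(A)|·(ζ/2π)^{|W|/2}·∫dγ e^{−(ζ/2)|K_W(A)γ + b|²} = 1` for every source window
`b` and every `ζ > 0` (gen 19's `fp_unity` at `K = K_W(A)`). [cite: MagnenRivasseauSeneor1993, (II.20) p.333 tl.27–31] -/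
theorem fp_unity_fpWindow_of_det_ne_zero (Sγ : Finset Momentum) (T : Finset (Fin 4 → ℤ)) (lam : ℝ) (A : VCoeff)
    (hdet : (fpWindow Sγ T lam A).det ≠ 0) {ζ : ℝ} (hζ : 0 < ζ) (b : ghostWindow Sγ → ℝ) :
    |(fpWindow Sγ T lam A).det| * Real.sqrt (ζ / (2 * Real.pi)) ^ Fintype.card (ghostWindow Sγ) *
      fpIntegral (fpWindow Sγ T lam A) b ζ = 1 :=
  fp_unity hdet hζ b

/-- **(II.20) in READING (FD) FOR `K(A)`, `A ≠ 0` ARBITRARY, FOR ALL SMALL COUPLINGS**: for every cut-off field `A`,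
every finite ghost window, every source window `b`, every `ζ > 0`, and every `λ` in a neighbourhood of `0`,
`|det K_W(A)|·(ζ/2π)^{|W|/2}·∫dγ e^{−(ζ/2)|K_W(A)γ + b|²} = 1` — gen 19's `fp_unity_smallCoupling` with its abstract `X`
instantiated to `X_W(A)`. [cite: MagnenRivasseauSeneor1993, (II.20) p.333 tl.27–31; p.329 tl.14–15; p.333 tl.41–46] -/
theorem fp_unity_fpWindow (Sγ : Finset Momentum) (T : Finset (Fin 4 → ℤ)) (A : VCoeff) {ζ : ℝ} (hζ : 0 < ζ)
    (b : ghostWindow Sγ → ℝ) :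
    ∀ᶠ lam in nhds (0 : ℝ), |(fpWindow Sγ T lam A).det| * Real.sqrt (ζ / (2 * Real.pi)) ^ Fintype.card (ghostWindow Sγ) *
      fpIntegral (fpWindow Sγ T lam A) b ζ = 1 :=
  (det_fpWindow_eventually_ne_zero Sγ T A).mono fun _ h => fp_unity h hζ b

/-! ## §4 The exponent of (II.20) on the window: with the source `b = ` the window of `∂·A`,
`|K_W(A)γ + b|² = Σ_{p∈Sγ} Σ_a |(∂_μA_μ^γ)~^a(p)|²` — the window `ℓ²`-norm of `∂_μA_μ^γ` for `A^γ = A + Dγ` (II.5) -/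

/-- The source window of (II.20): the real window coordinates of `(∂·A)~ = Σ_μ ik_μÃ_μ(k)` (gen 19's `divCoeff`).
[cite: MagnenRivasseauSeneor1993, (II.20) p.333 tl.29; §II.A p.328 tl.12–15] -/
def divWindow (Sγ : Finset Momentum) (A : VCoeff) : ghostWindow Sγ → ℝ := reImCoord Sγ (divCoeff A)

/-- **(II.5) for the cut-off field and a window ghost: `A^γ = A + Dγ`** with `D_μγ = ∂_μγ − λ[A_μ, γ]` (gen 5's
`covDCoeff`), as a coefficient function — the FIRST-ORDER gauge transformation under which the exponent of (II.20) is
quadratic in `γ` (gen 19's READING (LIN)). [cite: MagnenRivasseauSeneor1993, (II.5) p.329 tl.10–11; (II.20) p.333 tl.29–31] -/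
def gaugeInfCoeff (T : Finset (Fin 4 → ℤ)) (lam : ℝ) (A : VCoeff) (G : GCoeff) : VCoeff :=
  fun k μ => A k μ + covDCoeff T lam A G μ k

/-- `∂·A^γ = ∂·A + K(A)γ` as coefficient functions (gen 19's `divCoeff_gaugeInf`, as functions).
[cite: MagnenRivasseauSeneor1993, (II.20) p.333 tl.29–31; (II.5) p.329 tl.10–11] -/
theorem divCoeff_gaugeInfCoeff (T : Finset (Fin 4 → ℤ)) (lam : ℝ) (A : VCoeff) (G : GCoeff) :
    divCoeff (gaugeInfCoeff T lam A G) = divCoeff A + fpOpCoeff T lam A G :=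
  funext fun k => divCoeff_gaugeInf T lam A G k

/-- **The affine gauge-variation map of (II.20) in window coordinates: `reImCoord (∂·A^{γ̃(x)}) = K_W(A)·x + b`** with
`b = divWindow Sγ A` — the exponent's argument `∂_μA_μ^γ` IS the affine image `γ ↦ b + Kγ` of gen 19's `fpIntegral`,
for THE Faddeev–Popov window matrix. [cite: MagnenRivasseauSeneor1993, (II.20) p.333 tl.29–31; (II.5) p.329 tl.10–11] -/
theorem reImCoord_div_gaugeInfCoeff (Sγ : Finset Momentum) (T : Finset (Fin 4 → ℤ)) (lam : ℝ) (A : VCoeff)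
    (x : ghostWindow Sγ → ℝ) :
    reImCoord Sγ (divCoeff (gaugeInfCoeff T lam A (gcoeffW Sγ x))) = fpWindow Sγ T lam A *ᵥ x + divWindow Sγ A := by
  rw [divCoeff_gaugeInfCoeff, reImCoord_add, fpWindow_mulVec, divWindow, add_comm]

/-- **THE EXPONENT OF (II.20) ON THE WINDOW**: `|K_W(A)·x + b|² = Σ_{p∈Sγ} Σ_a |(∂_μA_μ^{γ̃(x)})~^a(p)|²` — the squared
norm in gen 19's `fpIntegral (fpWindow …) (divWindow …)` is the window `ℓ²`-norm of the divergence of the gauge-transformed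
field, i.e. the window Parseval form of «(∂_μA_μ^γ)²» integrated over `Λ` (READING (P); the position-space side of
Parseval for cut-off fields is gen 9's `…MRS93PositionSpaceFields`, not re-imported here).
[cite: MagnenRivasseauSeneor1993, (II.20) p.333 tl.29; §II.A p.328 tl.37–42] -/
theorem fpExponent_eq (Sγ : Finset Momentum) (T : Finset (Fin 4 → ℤ)) (lam : ℝ) (A : VCoeff)
    (x : ghostWindow Sγ → ℝ) :
    (fpWindow Sγ T lam A *ᵥ x + divWindow Sγ A) ⬝ᵥ (fpWindow Sγ T lam A *ᵥ x + divWindow Sγ A) =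
      ∑ p ∈ Sγ, ∑ a : Fin 3, Complex.normSq (divCoeff (gaugeInfCoeff T lam A (gcoeffW Sγ x)) p.1 a) := by
  rw [← reImCoord_div_gaugeInfCoeff, reImCoord_dotProduct_self]

/-- **`∫dγ e^{−(ζ/2)(∂_μA_μ^γ)²}` OF (II.20) ON THE WINDOW, LITERALLY**: gen 19's `fpIntegral` at `K = K_W(A)`, `b = ` window
of `∂·A` equals `∫dx e^{−(ζ/2) Σ_{p∈Sγ}Σ_a |(∂_μA_μ^{γ̃(x)})~^a(p)|²}` over the real window coordinates `x` of `γ`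
(Lebesgue measure on the flat Lie-algebra variable, p.333 tl.35–37). [cite: MagnenRivasseauSeneor1993, (II.20) p.333 tl.29, tl.35–37] -/
theorem fpIntegral_fpWindow_eq (Sγ : Finset Momentum) (T : Finset (Fin 4 → ℤ)) (lam : ℝ) (A : VCoeff) (ζ : ℝ) :
    fpIntegral (fpWindow Sγ T lam A) (divWindow Sγ A) ζ =
      ∫ x : ghostWindow Sγ → ℝ, Real.exp (-(ζ / 2) *
        ∑ p ∈ Sγ, ∑ a : Fin 3, Complex.normSq (divCoeff (gaugeInfCoeff T lam A (gcoeffW Sγ x)) p.1 a)) := by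
  unfold fpIntegral
  refine integral_congr_ae (Filter.Eventually.of_forall fun x => ?_)
  beta_reduce
  rw [fpExponent_eq]

/-- **(II.20) AS PRINTED, IN READING (FD)+(P), FOR THE CUT-OFF FIELD `A` ON A FINITE GHOST WINDOW, whenever `K_W(A)` is
invertible**: `|det K_W(A)| · (ζ/2π)^{|W|/2} · ∫dγ e^{−(ζ/2) Σ_{p∈Sγ}Σ_a |(∂_μA_μ^γ)~^a(p)|²} = 1`, `A^γ = A + Dγ` (II.5) —
every symbol of the display concrete: `det` of THE Faddeev–Popov window matrix, `∫dγ` Lebesgue on the window coordinates,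
the exponent the window norm of `∂_μA_μ^γ`; the Gaussian constant `(ζ/2π)^{|W|/2}` the print absorbs is restored (gen 19,
precision (ad) on `|det|` vs `det` inherited). [cite: MagnenRivasseauSeneor1993, (II.20) p.333 tl.27–31; (II.5) p.329 tl.10–11] -/
theorem fp_unity_window_of_det_ne_zero (Sγ : Finset Momentum) (T : Finset (Fin 4 → ℤ)) (lam : ℝ) (A : VCoeff)
    (hdet : (fpWindow Sγ T lam A).det ≠ 0) {ζ : ℝ} (hζ : 0 < ζ) :
    |(fpWindow Sγ T lam A).det| * Real.sqrt (ζ / (2 * Real.pi)) ^ Fintype.card (ghostWindow Sγ) *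
      ∫ x : ghostWindow Sγ → ℝ, Real.exp (-(ζ / 2) *
        ∑ p ∈ Sγ, ∑ a : Fin 3, Complex.normSq (divCoeff (gaugeInfCoeff T lam A (gcoeffW Sγ x)) p.1 a)) = 1 := by
  rw [← fpIntegral_fpWindow_eq]
  exact fp_unity hdet hζ _

/-- **(II.20) AS PRINTED, IN READING (FD)+(P), FOR EVERY CUT-OFF FIELD `A` ON EVERY FINITE GHOST WINDOW, FOR ALL SMALL
COUPLINGS**: for `λ` in a neighbourhood of `0`,
`|det K_W(A)| · (ζ/2π)^{|W|/2} · ∫dγ e^{−(ζ/2) Σ_{p∈Sγ}Σ_a |(∂_μA_μ^γ)~^a(p)|²} = 1` — «for small fields the formula performs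
its usual job of integrating out gauge degrees of freedom and changing the gauge at the price of a Fadeev-Popov
determinant» (p.333 tl.44–46); here: for small COUPLING at fixed cut-off field, the regime `λ → 0` of p.329 tl.14–15.
[cite: MagnenRivasseauSeneor1993, (II.20) p.333 tl.27–31, tl.41–46; (II.5) p.329 tl.10–11; p.329 tl.14–15] -/
theorem fp_unity_window (Sγ : Finset Momentum) (T : Finset (Fin 4 → ℤ)) (A : VCoeff) {ζ : ℝ} (hζ : 0 < ζ) :
    ∀ᶠ lam in nhds (0 : ℝ), |(fpWindow Sγ T lam A).det| * Real.sqrt (ζ / (2 * Real.pi)) ^ Fintype.card (ghostWindow Sγ) *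
      ∫ x : ghostWindow Sγ → ℝ, Real.exp (-(ζ / 2) *
        ∑ p ∈ Sγ, ∑ a : Fin 3, Complex.normSq (divCoeff (gaugeInfCoeff T lam A (gcoeffW Sγ x)) p.1 a)) = 1 :=
  (det_fpWindow_eventually_ne_zero Sγ T A).mono fun lam h => fp_unity_window_of_det_ne_zero Sγ T lam A h hζ

/-- «This formula in itself cannot contain any new information» (p.333 tl.32): inserted under ANY integral `∫F(A)dμ(A)`
over cut-off fields, the window form of (II.20) changes nothing — for each `A` at which `K_W(A)` is invertible.
[cite: MagnenRivasseauSeneor1993, (II.20) p.333 tl.32–34] -/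
theorem integral_mul_fp_unity_window {Ω : Type*} [MeasurableSpace Ω] (μ : Measure Ω) (F : Ω → ℝ)
    (Sγ : Finset Momentum) (T : Finset (Fin 4 → ℤ)) (lam : ℝ) (A : Ω → VCoeff)
    (hdet : ∀ ω, (fpWindow Sγ T lam (A ω)).det ≠ 0) {ζ : ℝ} (hζ : 0 < ζ) :
    ∫ ω, F ω * (|(fpWindow Sγ T lam (A ω)).det| * Real.sqrt (ζ / (2 * Real.pi)) ^ Fintype.card (ghostWindow Sγ) *
      ∫ x : ghostWindow Sγ → ℝ, Real.exp (-(ζ / 2) *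
        ∑ p ∈ Sγ, ∑ a : Fin 3, Complex.normSq (divCoeff (gaugeInfCoeff T lam (A ω) (gcoeffW Sγ x)) p.1 a))) ∂μ =
      ∫ ω, F ω ∂μ := by
  refine integral_congr_ae (Filter.Eventually.of_forall fun ω => ?_)
  simp only [fp_unity_window_of_det_ne_zero Sγ T lam (A ω) (hdet ω) hζ, mul_one]

/-! ## §5 `det K_W(A)` is a polynomial in the coupling: (II.20) on the window holds for ALL BUT FINITELY MANY `λ` -/

/-- `det(Δ_W − t·X)` as a polynomial in the coupling `t` (entries `−|p|²δ − t·X` in `ℝ[t]`).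
[cite: MagnenRivasseauSeneor1993, (II.20) p.333 tl.29–31; p.329 tl.14–15] -/
def detPoly (W : Finset GhostMode) (X : Matrix W W ℝ) : Polynomial ℝ :=
  ((laplaceWindow W).map Polynomial.C - (Polynomial.X : Polynomial ℝ) • X.map Polynomial.C).det

/-- Evaluating the determinant polynomial at a coupling gives the determinant: `P(λ) = det(Δ_W − λX)`.
[cite: MagnenRivasseauSeneor1993, (II.20) p.333 tl.29–31] -/
theorem eval_detPoly (W : Finset GhostMode) (X : Matrix W W ℝ) (lam : ℝ) :
    (detPoly W X).eval lam = (laplaceWindow W - lam • X).det := by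
  unfold detPoly
  rw [← Polynomial.coe_evalRingHom, RingHom.map_det, RingHom.mapMatrix_apply]
  congr 1
  ext i j
  simp [Matrix.map_apply, Matrix.sub_apply, Matrix.smul_apply]
  exact mul_comm _ _

/-- The determinant polynomial is not the zero polynomial: its value at `λ = 0` is `det Δ_W ≠ 0` (deleted zero mode).
[cite: MagnenRivasseauSeneor1993, (II.20) p.333 tl.29–31; §II.A p.328 tl.13–15] -/
theorem detPoly_ne_zero (W : Finset GhostMode) (X : Matrix W W ℝ) : detPoly W X ≠ 0 := by
  intro h
  have h0 := eval_detPoly W X 0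
  rw [h, Polynomial.eval_zero, zero_smul, sub_zero] at h0
  exact det_laplaceWindow_ne_zero W h0.symm

/-- **`Δ_W − λX` is singular for only FINITELY MANY couplings `λ`** (the roots of a nonzero real polynomial).
[cite: MagnenRivasseauSeneor1993, (II.20) p.333 tl.29–31; §II.A p.328 tl.13–15] -/
theorem finite_setOf_det_laplaceWindow_sub_smul_eq_zero (W : Finset GhostMode) (X : Matrix W W ℝ) :
    Set.Finite {lam : ℝ | (laplaceWindow W - lam • X).det = 0} := by
  have h := Polynomial.finite_setOf_isRoot (detPoly_ne_zero W X)
  refine h.subset fun lam hlam => ?_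
  simp only [Set.mem_setOf_eq, Polynomial.IsRoot.def, eval_detPoly] at hlam ⊢
  exact hlam

/-- **The Faddeev–Popov window matrix `K_W(A)` of a cut-off field is invertible for all but finitely many couplings.**
[cite: MagnenRivasseauSeneor1993, (II.20) p.333 tl.29–31; §II.A p.328 tl.13–15] -/
theorem finite_setOf_det_fpWindow_eq_zero (Sγ : Finset Momentum) (T : Finset (Fin 4 → ℤ)) (A : VCoeff) :
    Set.Finite {lam : ℝ | (fpWindow Sγ T lam A).det = 0} := by
  simp_rw [fpWindow_eq]
  exact finite_setOf_det_laplaceWindow_sub_smul_eq_zero (ghostWindow Sγ) (fpFirstOrderWindow Sγ T A)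

/-- … equivalently `det K_W(A) ≠ 0` for cofinitely many `λ`. [cite: MagnenRivasseauSeneor1993, (II.20) p.333 tl.29–31] -/
theorem det_fpWindow_ne_zero_cofinite (Sγ : Finset Momentum) (T : Finset (Fin 4 → ℤ)) (A : VCoeff) :
    ∀ᶠ lam in Filter.cofinite, (fpWindow Sγ T lam A).det ≠ 0 := by
  rw [Filter.eventually_cofinite]
  refine (finite_setOf_det_fpWindow_eq_zero Sγ T A).subset fun lam h => ?_
  simpa using h

/-- **(II.20) AS PRINTED, IN READING (FD)+(P), FOR EVERY CUT-OFF FIELD ON EVERY FINITE GHOST WINDOW, FOR ALL BUT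
FINITELY MANY COUPLINGS** — the window form of the Faddeev–Popov unity fails at most on the finite set of `λ` where
`K_W(A)` is singular. [cite: MagnenRivasseauSeneor1993, (II.20) p.333 tl.27–34; (II.5) p.329 tl.10–11] -/
theorem fp_unity_window_cofinite (Sγ : Finset Momentum) (T : Finset (Fin 4 → ℤ)) (A : VCoeff) {ζ : ℝ} (hζ : 0 < ζ) :
    ∀ᶠ lam in Filter.cofinite, |(fpWindow Sγ T lam A).det| * Real.sqrt (ζ / (2 * Real.pi)) ^ Fintype.card (ghostWindow Sγ) *
      ∫ x : ghostWindow Sγ → ℝ, Real.exp (-(ζ / 2) *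
        ∑ p ∈ Sγ, ∑ a : Fin 3, Complex.normSq (divCoeff (gaugeInfCoeff T lam A (gcoeffW Sγ x)) p.1 a)) = 1 :=
  (det_fpWindow_ne_zero_cofinite Sγ T A).mono fun lam h => fp_unity_window_of_det_ne_zero Sγ T lam A h hζ

/-! ## §6 The REALITY-CONSTRAINED coordinates: `K_W(A)` on gen 6's representatives (independent coordinates of a
REAL ghost field, `γ̃(−p) = conj γ̃(p)`), for a momentum window closed under `p ↦ −p` -/

/-- The representative modes of the ghost window (gen 6's `rep`: positive momenta) — the INDEPENDENT real coordinates of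
a real ghost field on the window. [cite: MagnenRivasseauSeneor1993, §II.A p.328 tl.12–17; (II.20) p.333 tl.35–37] -/
abbrev repWindow (Sγ : Finset Momentum) : Finset GhostMode := (ghostWindow Sγ).image rep

/-- Reading a coefficient function at the representative modes only. [cite: MagnenRivasseauSeneor1993, §II.A p.328 tl.12–17] -/
def reImCoordRep (Sγ : Finset Momentum) (F : GCoeff) : repWindow Sγ → ℝ := fun m => reImOf F m.1

/-- `reImCoordRep` is additive … [cite: MagnenRivasseauSeneor1993, §II.A p.328 tl.12–17] -/
theorem reImCoordRep_add (Sγ : Finset Momentum) (F G : GCoeff) :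
    reImCoordRep Sγ (F + G) = reImCoordRep Sγ F + reImCoordRep Sγ G := by
  funext m
  rcases m with ⟨⟨p, a, b⟩, hm⟩
  cases b <;> simp [reImCoordRep, reImOf]

/-- … and `ℝ`-homogeneous. [cite: MagnenRivasseauSeneor1993, §II.A p.328 tl.12–17] -/
theorem reImCoordRep_smul (Sγ : Finset Momentum) (r : ℝ) (F : GCoeff) :
    reImCoordRep Sγ (r • F) = r • reImCoordRep Sγ F := by
  funext m
  rcases m with ⟨⟨p, a, b⟩, hm⟩
  cases b <;> simp [reImCoordRep, reImOf]

/-- `reImCoordRep (F − λ·G) = reImCoordRep F − λ·reImCoordRep G` for real `λ`. [cite: MagnenRivasseauSeneor1993, §II.A p.328 tl.12–17] -/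
theorem reImCoordRep_sub_smul (Sγ : Finset Momentum) (lam : ℝ) (F G : GCoeff) :
    reImCoordRep Sγ (fun k => F k - (lam : ℂ) • G k) = reImCoordRep Sγ F - lam • reImCoordRep Sγ G := by
  funext m
  rcases m with ⟨⟨p, a, b⟩, hm⟩
  cases b <;> simp [reImCoordRep, reImOf]

/-- **The window compression of `L` ON THE INDEPENDENT COORDINATES**: realify the representative coordinates `y` to the
whole window (gen 6's `realifyWindow`: the modes at `−p` are the `±` copies), read out `γ̃`, apply `L`, read back at the
representatives. [cite: MagnenRivasseauSeneor1993, (II.20) p.333 tl.29–37; §II.A p.328 tl.12–17] -/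
def windowOpRep (Sγ : Finset Momentum) (L : GCoeff → GCoeff)
    (hadd : ∀ η₁ η₂, L (η₁ + η₂) = L η₁ + L η₂) (hsmul : ∀ (r : ℝ) η, L (r • η) = r • L η) :
    (repWindow Sγ → ℝ) →ₗ[ℝ] (repWindow Sγ → ℝ) where
  toFun y := reImCoordRep Sγ (L (gcoeffW Sγ (realifyWindow ghostIm (ghostWindow Sγ) y)))
  map_add' y₁ y₂ := by rw [realifyWindow_add, gcoeffW_add, hadd, reImCoordRep_add]
  map_smul' r y := by rw [realifyWindow_smul, gcoeffW_smul, hsmul, reImCoordRep_smul]; rfl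

/-- Its square real matrix on the representative modes. [cite: MagnenRivasseauSeneor1993, (II.20) p.333 tl.29–31] -/
def windowMatrixRep (Sγ : Finset Momentum) (L : GCoeff → GCoeff)
    (hadd : ∀ η₁ η₂, L (η₁ + η₂) = L η₁ + L η₂) (hsmul : ∀ (r : ℝ) η, L (r • η) = r • L η) :
    Matrix (repWindow Sγ) (repWindow Sγ) ℝ :=
  LinearMap.toMatrix' (windowOpRep Sγ L hadd hsmul)

/-- The representative matrix IS the operator on realified coordinates. [cite: MagnenRivasseauSeneor1993, (II.20) p.333 tl.29–37] -/
theorem windowMatrixRep_mulVec (Sγ : Finset Momentum) (L : GCoeff → GCoeff)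
    (hadd : ∀ η₁ η₂, L (η₁ + η₂) = L η₁ + L η₂) (hsmul : ∀ (r : ℝ) η, L (r • η) = r • L η)
    (y : repWindow Sγ → ℝ) :
    windowMatrixRep Sγ L hadd hsmul *ᵥ y = reImCoordRep Sγ (L (gcoeffW Sγ (realifyWindow ghostIm (ghostWindow Sγ) y))) := by
  rw [windowMatrixRep, LinearMap.toMatrix'_mulVec]
  rfl

/-- A representative matrix is determined by its action. [cite: MagnenRivasseauSeneor1993, (II.20) p.333 tl.29–31] -/
theorem windowMatrixRep_eq_of_mulVec (Sγ : Finset Momentum) (L : GCoeff → GCoeff)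
    (hadd : ∀ η₁ η₂, L (η₁ + η₂) = L η₁ + L η₂) (hsmul : ∀ (r : ℝ) η, L (r • η) = r • L η)
    {M : Matrix (repWindow Sγ) (repWindow Sγ) ℝ}
    (h : ∀ y, reImCoordRep Sγ (L (gcoeffW Sγ (realifyWindow ghostIm (ghostWindow Sγ) y))) = M *ᵥ y) :
    windowMatrixRep Sγ L hadd hsmul = M := by
  rw [← LinearMap.toMatrix'_toLin' M, windowMatrixRep]
  congr 1
  refine LinearMap.ext fun y => ?_
  rw [Matrix.toLin'_apply, ← h y]
  rfl

/-- Representative modes sit at positive momenta … [cite: MagnenRivasseauSeneor1993, §II.A p.328 tl.12–17] -/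
theorem isPos_of_mem_repWindow {Sγ : Finset Momentum} {m : GhostMode} (hm : m ∈ repWindow Sγ) : m.1.IsPos := by
  obtain ⟨m₀, -, rfl⟩ := Finset.mem_image.mp hm
  unfold rep
  split_ifs with h
  · exact h
  · exact (Momentum.isPos_or_isPos_neg m₀.1).resolve_left h

/-- … and are their own representatives. [cite: MagnenRivasseauSeneor1993, §II.A p.328 tl.12–17] -/
theorem rep_eq_self_of_mem_repWindow {Sγ : Finset Momentum} {m : GhostMode} (hm : m ∈ repWindow Sγ) : rep m = m := by
  unfold rep
  rw [if_pos (isPos_of_mem_repWindow hm)]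

/-- On a momentum window closed under `p ↦ −p` the representative modes belong to the window.
[cite: MagnenRivasseauSeneor1993, §II.A p.328 tl.12–17] -/
theorem repWindow_subset {Sγ : Finset Momentum} (hS : ∀ p ∈ Sγ, p.neg ∈ Sγ) : repWindow Sγ ⊆ ghostWindow Sγ := by
  intro m hm
  obtain ⟨m₀, hm₀, rfl⟩ := Finset.mem_image.mp hm
  unfold rep
  split_ifs
  · exact hm₀
  · exact mem_ghostWindow.mpr (hS _ (mem_ghostWindow.mp hm₀))

/-- Realified coordinates read at a representative mode give back the independent coordinate: `x(m) = y(m)` for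
`m ∈ rep(W)` (no sign: `m` has positive momentum). [cite: MagnenRivasseauSeneor1993, §II.A p.328 tl.12–17] -/
theorem realifyWindow_apply_rep {Sγ : Finset Momentum} (hS : ∀ p ∈ Sγ, p.neg ∈ Sγ) (y : repWindow Sγ → ℝ)
    (m : repWindow Sγ) :
    realifyWindow ghostIm (ghostWindow Sγ) y ⟨m.1, repWindow_subset hS m.2⟩ = y m := by
  have hrep : rep m.1 = m.1 := rep_eq_self_of_mem_repWindow m.2
  have hpos : m.1.1.IsPos := isPos_of_mem_repWindow m.2
  unfold realifyWindow sgn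
  rw [if_pos hpos, one_mul]
  congr 1
  exact Subtype.ext hrep

/-- **ON THE INDEPENDENT COORDINATES THE FREE LAPLACIAN IS AGAIN `diag(−|p|²)`** (gen 19's `laplaceWindow` on the
representative modes), for a window closed under `p ↦ −p`. [cite: MagnenRivasseauSeneor1993, (II.20) p.333 tl.29–31; §II.A p.328 tl.12–17] -/
theorem windowMatrixRep_laplaceCoeff {Sγ : Finset Momentum} (hS : ∀ p ∈ Sγ, p.neg ∈ Sγ) :
    windowMatrixRep Sγ laplaceCoeff laplaceCoeff_add_fun laplaceCoeff_real_smul = laplaceWindow (repWindow Sγ) := by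
  refine windowMatrixRep_eq_of_mulVec Sγ laplaceCoeff laplaceCoeff_add_fun laplaceCoeff_real_smul fun y => ?_
  funext m
  rw [laplaceWindow_mulVec]
  have hm : m.1 ∈ ghostWindow Sγ := repWindow_subset hS m.2
  have hx := congrFun (reImCoord_gcoeffW Sγ (realifyWindow ghostIm (ghostWindow Sγ) y)) ⟨m.1, hm⟩
  rw [realifyWindow_apply_rep hS y m] at hx
  rcases m with ⟨⟨p, a, b⟩, hm'⟩
  simp only [reImCoordRep, reImCoord, reImOf] at hx ⊢
  rw [laplaceCoeff_eq_laplaceSymbol_mul _ p a]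
  cases b
  · simp only [Bool.false_eq_true, ↓reduceIte, Complex.re_ofReal_mul] at hx ⊢
    rw [hx]
  · simp only [↓reduceIte, Complex.im_ofReal_mul] at hx ⊢
    rw [hx]

/-- Representative matrices are linear in the operator. [cite: MagnenRivasseauSeneor1993, (II.20) p.333 tl.29–31] -/
theorem windowMatrixRep_sub_smul (Sγ : Finset Momentum) (lam : ℝ) (L L₁ L₂ : GCoeff → GCoeff)
    (hadd : ∀ η₁ η₂, L (η₁ + η₂) = L η₁ + L η₂) (hsmul : ∀ (r : ℝ) η, L (r • η) = r • L η)
    (hadd₁ : ∀ η₁ η₂, L₁ (η₁ + η₂) = L₁ η₁ + L₁ η₂) (hsmul₁ : ∀ (r : ℝ) η, L₁ (r • η) = r • L₁ η)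
    (hadd₂ : ∀ η₁ η₂, L₂ (η₁ + η₂) = L₂ η₁ + L₂ η₂) (hsmul₂ : ∀ (r : ℝ) η, L₂ (r • η) = r • L₂ η)
    (hL : ∀ η k, L η k = L₁ η k - (lam : ℂ) • L₂ η k) :
    windowMatrixRep Sγ L hadd hsmul =
      windowMatrixRep Sγ L₁ hadd₁ hsmul₁ - lam • windowMatrixRep Sγ L₂ hadd₂ hsmul₂ := by
  refine windowMatrixRep_eq_of_mulVec Sγ L hadd hsmul fun y => ?_
  rw [Matrix.sub_mulVec, Matrix.smul_mulVec, windowMatrixRep_mulVec, windowMatrixRep_mulVec, ← reImCoordRep_sub_smul]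
  congr 1
  funext k
  exact hL _ k

/-- **`K^rep_W(A)` — the Faddeev–Popov matrix on the INDEPENDENT coordinates of a real ghost field.**
[cite: MagnenRivasseauSeneor1993, (II.20) p.333 tl.29–37; §II.A p.328 tl.12–17] -/
def fpWindowRep (Sγ : Finset Momentum) (T : Finset (Fin 4 → ℤ)) (lam : ℝ) (A : VCoeff) :
    Matrix (repWindow Sγ) (repWindow Sγ) ℝ :=
  windowMatrixRep Sγ (fpOpCoeff T lam A) (fpOpCoeff_add_fun T lam A) (fpOpCoeff_real_smul T lam A)

/-- `X^rep_W(A)` — the first-order part on the independent coordinates. [cite: MagnenRivasseauSeneor1993, (II.20) p.333 tl.30–31] -/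
def fpFirstOrderWindowRep (Sγ : Finset Momentum) (T : Finset (Fin 4 → ℤ)) (A : VCoeff) :
    Matrix (repWindow Sγ) (repWindow Sγ) ℝ :=
  windowMatrixRep Sγ (fpFirstOrder T A) (fpFirstOrder_add T A) (fpFirstOrder_smul T A)

/-- **`K^rep_W(A) = Δ^rep_W − λ·X^rep_W(A)`** on a window closed under `p ↦ −p`. [cite: MagnenRivasseauSeneor1993, (II.20) p.333 tl.29–31; (II.5) p.329 tl.10–11] -/
theorem fpWindowRep_eq {Sγ : Finset Momentum} (hS : ∀ p ∈ Sγ, p.neg ∈ Sγ) (T : Finset (Fin 4 → ℤ)) (lam : ℝ)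
    (A : VCoeff) :
    fpWindowRep Sγ T lam A = laplaceWindow (repWindow Sγ) - lam • fpFirstOrderWindowRep Sγ T A := by
  rw [← windowMatrixRep_laplaceCoeff hS]
  exact windowMatrixRep_sub_smul Sγ lam _ _ _ _ _ _ _ _ _ (fpOpCoeff_eq_laplace_sub T lam A)

/-- `K^rep_W(A)` is singular for only finitely many couplings. [cite: MagnenRivasseauSeneor1993, (II.20) p.333 tl.29–31; §II.A p.328 tl.13–15] -/
theorem finite_setOf_det_fpWindowRep_eq_zero {Sγ : Finset Momentum} (hS : ∀ p ∈ Sγ, p.neg ∈ Sγ)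
    (T : Finset (Fin 4 → ℤ)) (A : VCoeff) :
    Set.Finite {lam : ℝ | (fpWindowRep Sγ T lam A).det = 0} := by
  simp_rw [fpWindowRep_eq hS]
  exact finite_setOf_det_laplaceWindow_sub_smul_eq_zero (repWindow Sγ) (fpFirstOrderWindowRep Sγ T A)

/-- **(II.20) in READING (FD) ON THE INDEPENDENT COORDINATES OF A REAL GHOST FIELD**, for every cut-off field `A`, every
momentum window closed under `p ↦ −p`, every source `b`, every `ζ > 0`, for all but finitely many couplings:
`|det K^rep_W(A)|·(ζ/2π)^{|rep W|/2}·∫dy e^{−(ζ/2)|K^rep_W(A)y + b|²} = 1`. [cite: MagnenRivasseauSeneor1993, (II.20) p.333 tl.27–37; §II.A p.328 tl.12–17] -/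
theorem fp_unity_fpWindowRep_cofinite {Sγ : Finset Momentum} (hS : ∀ p ∈ Sγ, p.neg ∈ Sγ) (T : Finset (Fin 4 → ℤ))
    (A : VCoeff) {ζ : ℝ} (hζ : 0 < ζ) (b : repWindow Sγ → ℝ) :
    ∀ᶠ lam in Filter.cofinite, |(fpWindowRep Sγ T lam A).det| * Real.sqrt (ζ / (2 * Real.pi)) ^ Fintype.card (repWindow Sγ) *
      fpIntegral (fpWindowRep Sγ T lam A) b ζ = 1 := by
  have h : ∀ᶠ lam in Filter.cofinite, (fpWindowRep Sγ T lam A).det ≠ 0 := by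
    rw [Filter.eventually_cofinite]
    refine (finite_setOf_det_fpWindowRep_eq_zero hS T A).subset fun lam h => ?_
    simpa using h
  exact h.mono fun _ hd => fp_unity hd hζ b

/-- … and for all couplings in a neighbourhood of `0`. [cite: MagnenRivasseauSeneor1993, (II.20) p.333 tl.27–37; p.329 tl.14–15] -/
theorem fp_unity_fpWindowRep {Sγ : Finset Momentum} (hS : ∀ p ∈ Sγ, p.neg ∈ Sγ) (T : Finset (Fin 4 → ℤ))
    (A : VCoeff) {ζ : ℝ} (hζ : 0 < ζ) (b : repWindow Sγ → ℝ) :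
    ∀ᶠ lam in nhds (0 : ℝ), |(fpWindowRep Sγ T lam A).det| * Real.sqrt (ζ / (2 * Real.pi)) ^ Fintype.card (repWindow Sγ) *
      fpIntegral (fpWindowRep Sγ T lam A) b ζ = 1 := by
  have h : ∀ᶠ lam in nhds (0 : ℝ), (fpWindowRep Sγ T lam A).det ≠ 0 := by
    simp_rw [fpWindowRep_eq hS]
    exact det_laplaceWindow_sub_smul_eventually_ne_zero (repWindow Sγ) (fpFirstOrderWindowRep Sγ T A)
  exact h.mono fun _ hd => fp_unity hd hζ b

/-! ## §7 REALITY: for a REAL cut-off field `A`, `K(A)` maps real ghost fields to real ones, and the window matrix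
intertwines gen 6's realification — on a window closed under `p ↦ −p` nothing of `K(A)γ` is lost by reading the
representatives -/

/-- The reality constraint of a ghost-type coefficient function: `F̃(−k) = conj F̃(k)` (Fourier transform of a REAL
field). [cite: MagnenRivasseauSeneor1993, §II.A p.328 tl.12–17] -/
def IsRealCoeff (F : GCoeff) : Prop := ∀ k a, F (-k) a = (starRingEnd ℂ) (F k a)

/-- The reality constraint of a vector-type coefficient function: `Ã_μ(−k) = conj Ã_μ(k)`. [cite: MagnenRivasseauSeneor1993, §II.A p.328 tl.12–17] -/
def IsRealVCoeff (A : VCoeff) : Prop := ∀ k μ a, A (-k) μ a = (starRingEnd ℂ) (A k μ a)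

/-- `∂_μ` preserves reality: `(ik_μF̃)` is conjugation-symmetric if `F̃` is. [cite: MagnenRivasseauSeneor1993, §II.A p.328 tl.12–17] -/
theorem isRealCoeff_dCoeff {F : GCoeff} (hF : IsRealCoeff F) (μ : Fin 4) : IsRealCoeff fun k => dCoeff F μ k := by
  intro k a
  simp only [dCoeff, Pi.neg_apply, Int.cast_neg, hF k a, map_mul, Complex.conj_I, map_intCast]
  ring

/-- The wedge product of conjugates is the conjugate of the wedge product (real structure constants).
[cite: MagnenRivasseauSeneor1993, §II.A p.328 tl.32–33] -/
theorem cross_conj (u v : Fin 3 → ℂ) :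
    (fun b => (starRingEnd ℂ) (u b)) ⨯₃ (fun c => (starRingEnd ℂ) (v c)) = fun a => (starRingEnd ℂ) ((u ⨯₃ v) a) := by
  funext a
  fin_cases a <;> simp [cross_apply]

/-- The wedge-product convolution over a momentum set closed under `k ↦ −k` preserves reality.
[cite: MagnenRivasseauSeneor1993, §II.A p.328 tl.12–17, tl.32–33] -/
theorem isRealCoeff_convCross {U : Finset (Fin 4 → ℤ)} (hU : ∀ q ∈ U, -q ∈ U) {X Y : GCoeff}
    (hX : IsRealCoeff X) (hY : IsRealCoeff Y) : IsRealCoeff (convCross U X Y) := by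
  intro k a
  unfold convCross
  rw [Finset.sum_apply, Finset.sum_apply, map_sum]
  refine Finset.sum_nbij' (fun q => -q) (fun q => -q) (fun q hq => hU q hq) (fun q hq => hU q hq)
    (fun q _ => neg_neg q) (fun q _ => neg_neg q) fun q hq => ?_
  rw [Finset.sum_apply, Finset.sum_apply, map_sum]
  refine Finset.sum_nbij' (fun r => -r) (fun r => -r) (fun r hr => hU r hr) (fun r hr => hU r hr)
    (fun r _ => neg_neg r) (fun r _ => neg_neg r) fun r hr => ?_
  have hiff : (-q + -r = k) ↔ (q + r = -k) := by rw [← neg_add, neg_eq_iff_eq_neg]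
  by_cases h : q + r = -k
  · rw [if_pos h, if_pos (hiff.mpr h), show X (-q) = fun b => (starRingEnd ℂ) (X q b) from funext (hX q),
      show Y (-r) = fun c => (starRingEnd ℂ) (Y r c) from funext (hY r), cross_conj]
    simp
  · rw [if_neg h, if_neg (fun h' => h (hiff.mp h'))]
    simp

/-- The Laplacian preserves reality. [cite: MagnenRivasseauSeneor1993, §II.A p.328 tl.12–17] -/
theorem isRealCoeff_laplaceCoeff {F : GCoeff} (hF : IsRealCoeff F) : IsRealCoeff (laplaceCoeff F) := by
  intro k a
  unfold laplaceCoeff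
  rw [Finset.sum_apply, Finset.sum_apply, map_sum]
  exact Finset.sum_congr rfl fun μ _ => isRealCoeff_dCoeff (isRealCoeff_dCoeff hF μ) μ k a

/-- `{0} ∪ T` is closed under `k ↦ −k` when `T` is. [cite: MagnenRivasseauSeneor1993, §II.A p.328 tl.12–15] -/
theorem neg_mem_insert_zero {T : Finset (Fin 4 → ℤ)} (hT : ∀ q ∈ T, -q ∈ T) : ∀ q ∈ insert 0 T, -q ∈ insert 0 T := by
  intro q hq
  rcases Finset.mem_insert.mp hq with rfl | h
  · simp
  · exact Finset.mem_insert_of_mem (hT q h)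

/-- The first-order part `∂_μ[A_μ, ·]` preserves reality for a real cut-off field on a momentum set closed under `k ↦ −k`.
[cite: MagnenRivasseauSeneor1993, §II.A p.328 tl.12–17; (II.5) p.329] -/
theorem isRealCoeff_fpFirstOrder {T : Finset (Fin 4 → ℤ)} (hT : ∀ q ∈ T, -q ∈ T) {A : VCoeff} (hA : IsRealVCoeff A)
    {F : GCoeff} (hF : IsRealCoeff F) : IsRealCoeff (fpFirstOrder T A F) := by
  intro k a
  unfold fpFirstOrder
  rw [Finset.sum_apply, Finset.sum_apply, map_sum]
  refine Finset.sum_congr rfl fun μ _ => ?_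
  exact isRealCoeff_dCoeff (isRealCoeff_convCross (neg_mem_insert_zero hT) (fun q b => hA q μ b) hF) μ k a

/-- **`K(A) = ∂_μD_μ` MAPS REAL GHOST FIELDS TO REAL ONES** for a real cut-off field `A` (real coupling, products cut off
at a set closed under `k ↦ −k`). [cite: MagnenRivasseauSeneor1993, (II.20) p.333 tl.29–37; §II.A p.328 tl.12–17] -/
theorem isRealCoeff_fpOpCoeff {T : Finset (Fin 4 → ℤ)} (hT : ∀ q ∈ T, -q ∈ T) (lam : ℝ) {A : VCoeff}
    (hA : IsRealVCoeff A) {F : GCoeff} (hF : IsRealCoeff F) : IsRealCoeff (fpOpCoeff T lam A F) := by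
  intro k a
  rw [fpOpCoeff_eq_laplace_sub, fpOpCoeff_eq_laplace_sub, Pi.sub_apply, Pi.sub_apply, Pi.smul_apply, Pi.smul_apply,
    map_sub, isRealCoeff_laplaceCoeff hF k a, smul_eq_mul, smul_eq_mul, map_mul, Complex.conj_ofReal,
    isRealCoeff_fpFirstOrder hT hA hF k a]

/-- **The read-out of REALIFIED coordinates is a real field**: `γ̃(realifyWindow y)(−k) = conj γ̃(realifyWindow y)(k)` on a
momentum window closed under `p ↦ −p` (the ghost twin of gen 5's `coeff_realify_neg`). [cite: MagnenRivasseauSeneor1993, §II.A p.328 tl.12–17; (II.36) p.339] -/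
theorem isRealCoeff_gcoeffW_realifyWindow {Sγ : Finset Momentum} (hS : ∀ p ∈ Sγ, p.neg ∈ Sγ)
    (y : repWindow Sγ → ℝ) : IsRealCoeff (gcoeffW Sγ (realifyWindow ghostIm (ghostWindow Sγ) y)) := by
  intro k a
  by_cases hk : k = 0
  · subst hk
    simp [gcoeffW]
  have hnk : -k ≠ 0 := fun h => hk (neg_eq_zero.mp h)
  by_cases hp : (⟨k, hk⟩ : Momentum) ∈ Sγ
  · have hpn : (⟨-k, hnk⟩ : Momentum) ∈ Sγ := hS _ hp
    have e1 := gcoeffW_apply_mem Sγ (realifyWindow ghostIm (ghostWindow Sγ) y) ⟨k, hk⟩ hp a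
    have e2 := gcoeffW_apply_mem Sγ (realifyWindow ghostIm (ghostWindow Sγ) y) ⟨-k, hnk⟩ hpn a
    simp only at e1 e2
    rw [e1, e2]
    have hneg : (⟨-k, hnk⟩ : Momentum) = Momentum.neg ⟨k, hk⟩ := rfl
    unfold realifyWindow windowMode
    simp only [hneg, sgn, ghostIm, rep_neg, map_add, map_mul, Complex.conj_ofReal, Complex.conj_I]
    rcases Momentum.isPos_or_isPos_neg ⟨k, hk⟩ with h | h
    · have hn : ¬ (Momentum.neg ⟨k, hk⟩).IsPos := Momentum.not_isPos_neg_of_isPos h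
      simp [h, hn]
    · have hn : ¬ Momentum.IsPos ⟨k, hk⟩ := fun h' => Momentum.not_isPos_neg_of_isPos h' h
      simp [h, hn]
  · have hpn : (⟨-k, hnk⟩ : Momentum) ∉ Sγ := by
      intro h'
      have := hS _ h'
      exact hp (by simpa [Momentum.neg] using this)
    unfold gcoeffW
    rw [dif_neg hnk, dif_neg hk]
    simp only [dif_neg hpn, dif_neg hp, map_zero]

/-- For a REAL coefficient function the window coordinate at any mode is `±` the coordinate at its representative:
`Re F̃(−p) = Re F̃(p)`, `Im F̃(−p) = −Im F̃(p)` (gen 2's `sgn`). [cite: MagnenRivasseauSeneor1993, §II.A p.328 tl.12–17] -/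
theorem reImOf_eq_sgn_mul_rep {F : GCoeff} (hF : IsRealCoeff F) (m : GhostMode) :
    reImOf F m = sgn ghostIm m * reImOf F (rep m) := by
  rcases m with ⟨p, a, b⟩
  unfold rep sgn
  by_cases hp : p.IsPos
  · simp [hp]
  · have hval : F p.neg.1 a = (starRingEnd ℂ) (F p.1 a) := hF p.1 a
    cases b
    · simp [hp, reImOf, ghostIm, hval, Complex.conj_re]
    · simp [hp, reImOf, ghostIm, hval, Complex.conj_im]

/-- **THE WINDOW MATRIX INTERTWINES REALIFICATION: `K_W(A)·R(y) = R(K^rep_W(A)·y)`** with `R = realifyWindow` — for a REAL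
cut-off field `A` on a momentum window and a product set closed under `k ↦ −k`, the Faddeev–Popov window matrix of §3
maps realified coordinates to realified coordinates, and on them it IS §6's representative matrix: nothing of `K(A)γ`
is lost by reading the independent coordinates of a real `γ`. [cite: MagnenRivasseauSeneor1993, (II.20) p.333 tl.29–37; §II.A p.328 tl.12–17] -/
theorem fpWindow_mulVec_realifyWindow {Sγ : Finset Momentum} (hS : ∀ p ∈ Sγ, p.neg ∈ Sγ) {T : Finset (Fin 4 → ℤ)}
    (hT : ∀ q ∈ T, -q ∈ T) (lam : ℝ) {A : VCoeff} (hA : IsRealVCoeff A) (y : repWindow Sγ → ℝ) :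
    fpWindow Sγ T lam A *ᵥ realifyWindow ghostIm (ghostWindow Sγ) y =
      realifyWindow ghostIm (ghostWindow Sγ) (fpWindowRep Sγ T lam A *ᵥ y) := by
  rw [fpWindow_mulVec, fpWindowRep, windowMatrixRep_mulVec]
  funext m
  have hF := isRealCoeff_fpOpCoeff hT lam hA (isRealCoeff_gcoeffW_realifyWindow hS y)
  show reImOf _ m.1 = sgn ghostIm m.1 * reImOf _ (rep m.1)
  exact reImOf_eq_sgn_mul_rep hF m.1

/-! ## §8 (v1.1) For a REAL cut-off field on a window closed under `p ↦ −p`: `K(A)` is `ℂ`-linear and commutes with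
conjugation, the window splits as (real fields) ⊕ i·(real fields), and `det K_W(A) = (det K^rep_W(A))² ≥ 0` — so the
display (II.20) holds with the SIGNED determinant «det[K(A)]» exactly as printed (precision (ad) of gen 19 adjudicated
in this case) -/

section SignedDeterminant

variable {Sγ : Finset Momentum}

/-- The mode with the opposite imaginary-part flag: `(p, a, Re) ↔ (p, a, Im)`. [cite: MagnenRivasseauSeneor1993, §II.A p.328 tl.12–17] -/
def flipMode (m : ghostWindow Sγ) : ghostWindow Sγ :=
  ⟨(m.1.1, m.1.2.1, !m.1.2.2), (mem_ghostWindow (m := (m.1.1, m.1.2.1, !m.1.2.2))).mpr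
    ((mem_ghostWindow (m := m.1)).mp m.2)⟩

/-- **Multiplication by `i` on the window coordinates**: `Re(iz) = −Im z`, `Im(iz) = Re z`.
[cite: MagnenRivasseauSeneor1993, §II.A p.328 tl.12–17; (II.20) p.333 tl.35–37] -/
def iMul (x : ghostWindow Sγ → ℝ) : ghostWindow Sγ → ℝ :=
  fun m => if m.1.2.2 then x (flipMode m) else -x (flipMode m)

/-- `γ̃(i·x) = i·γ̃(x)`: `iMul` IS multiplication by `i` on the read-out. [cite: MagnenRivasseauSeneor1993, §II.A p.328 tl.12–17] -/
theorem gcoeffW_iMul (x : ghostWindow Sγ → ℝ) : gcoeffW Sγ (iMul x) = Complex.I • gcoeffW Sγ x := by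
  funext k a
  rw [Pi.smul_apply, Pi.smul_apply, smul_eq_mul]
  by_cases hk : k = 0
  · subst hk; simp [gcoeffW]
  by_cases hp : (⟨k, hk⟩ : Momentum) ∈ Sγ
  · rw [gcoeffW_apply_mem Sγ (iMul x) ⟨k, hk⟩ hp a, gcoeffW_apply_mem Sγ x ⟨k, hk⟩ hp a]
    simp only [iMul, flipMode, windowMode, Bool.not_false, Bool.not_true, Bool.false_eq_true, ↓reduceIte,
      Complex.ofReal_neg]
    apply Complex.ext <;> simp
  · unfold gcoeffW
    rw [dif_neg hk, dif_neg hk]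
    simp only [dif_neg hp, mul_zero]

/-- `reImCoord (i·F) = iMul (reImCoord F)`. [cite: MagnenRivasseauSeneor1993, §II.A p.328 tl.12–17] -/
theorem reImCoord_I_smul (F : GCoeff) : reImCoord Sγ (Complex.I • F) = iMul (reImCoord Sγ F) := by
  funext m
  rcases m with ⟨⟨p, a, b⟩, hm⟩
  cases b <;> simp [reImCoord, reImOf, iMul, flipMode]

/-- `K(A)` is `ℂ`-homogeneous as a map of coefficient functions (gen 19's `fpOpCoeff_smul`, as functions).
[cite: MagnenRivasseauSeneor1993, (II.20) p.333 tl.30–37] -/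
theorem fpOpCoeff_smul_fun (T : Finset (Fin 4 → ℤ)) (lam : ℝ) (A : VCoeff) (c : ℂ) (η : GCoeff) :
    fpOpCoeff T lam A (c • η) = c • fpOpCoeff T lam A η :=
  funext fun k => fpOpCoeff_smul T lam A c η k

/-- **`K_W(A)` commutes with multiplication by `i`** (`K(A)` is `ℂ`-linear): `K_W(A)·(i·x) = i·(K_W(A)·x)`.
[cite: MagnenRivasseauSeneor1993, (II.20) p.333 tl.29–37] -/
theorem fpWindow_mulVec_iMul (T : Finset (Fin 4 → ℤ)) (lam : ℝ) (A : VCoeff) (x : ghostWindow Sγ → ℝ) :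
    fpWindow Sγ T lam A *ᵥ iMul x = iMul (fpWindow Sγ T lam A *ᵥ x) := by
  rw [fpWindow_mulVec, fpWindow_mulVec, gcoeffW_iMul, fpOpCoeff_smul_fun, reImCoord_I_smul]

variable (hS : ∀ p ∈ Sγ, p.neg ∈ Sγ)
include hS

/-- A representative mode as a mode of the window. [cite: MagnenRivasseauSeneor1993, §II.A p.328 tl.12–17] -/
def repIn (r : repWindow Sγ) : ghostWindow Sγ := ⟨r.1, repWindow_subset hS r.2⟩

/-- The PARTNER of a representative mode: the same label at `−p`. [cite: MagnenRivasseauSeneor1993, §II.A p.328 tl.12–17] -/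
def partner (r : repWindow Sγ) : ghostWindow Sγ :=
  ⟨(r.1.1.neg, r.1.2), mem_ghostWindow.mpr (hS _ (mem_ghostWindow.mp (repWindow_subset hS r.2)))⟩

/-- Realified coordinates at the partner mode: `+y` for a real part, `−y` for an imaginary part (`Re γ̃(−p) = Re γ̃(p)`,
`Im γ̃(−p) = −Im γ̃(p)`). [cite: MagnenRivasseauSeneor1993, §II.A p.328 tl.12–17] -/
theorem realifyWindow_apply_partner (y : repWindow Sγ → ℝ) (r : repWindow Sγ) :
    realifyWindow ghostIm (ghostWindow Sγ) y (partner hS r) = (if r.1.2.2 then -1 else 1) * y r := by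
  obtain ⟨⟨p, a, b⟩, hr⟩ := r
  have hpos : p.IsPos := isPos_of_mem_repWindow hr
  have hn : ¬ p.neg.IsPos := Momentum.not_isPos_neg_of_isPos hpos
  have hrep : rep ((p.neg, a, b) : GhostMode) = (p, a, b) := by
    rw [rep_neg]
    exact rep_eq_self_of_mem_repWindow hr
  have e1 : sgn ghostIm ((p.neg, a, b) : GhostMode) = (if b then -1 else 1) := by
    unfold sgn ghostIm
    simp [hn]
  unfold realifyWindow partner
  simp only
  rw [e1]
  congr 1
  congr 1
  exact Subtype.ext hrep

/-- Realified coordinates at the representative itself: `y`. [cite: MagnenRivasseauSeneor1993, §II.A p.328 tl.12–17] -/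
theorem realifyWindow_apply_repIn (y : repWindow Sγ → ℝ) (r : repWindow Sγ) :
    realifyWindow ghostIm (ghostWindow Sγ) y (repIn hS r) = y r :=
  realifyWindow_apply_rep hS y r

/-- On a window closed under `p ↦ −p`: a mode is a representative iff its momentum is positive and in the window.
[cite: MagnenRivasseauSeneor1993, §II.A p.328 tl.12–17] -/
theorem mem_repWindow_iff {m : GhostMode} : m ∈ repWindow Sγ ↔ m.1.IsPos ∧ m.1 ∈ Sγ := by
  constructor
  · exact fun h => ⟨isPos_of_mem_repWindow h, (mem_ghostWindow (m := m)).mp (repWindow_subset hS h)⟩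
  · rintro ⟨h1, h2⟩
    refine Finset.mem_image.mpr ⟨m, (mem_ghostWindow (m := m)).mpr h2, ?_⟩
    unfold rep
    rw [if_pos h1]

/-- The representative with the opposite imaginary-part flag. [cite: MagnenRivasseauSeneor1993, §II.A p.328 tl.12–17] -/
def flipRep (r : repWindow Sγ) : repWindow Sγ :=
  ⟨(r.1.1, r.1.2.1, !r.1.2.2), (mem_repWindow_iff hS (m := (r.1.1, r.1.2.1, !r.1.2.2))).mpr
    ⟨isPos_of_mem_repWindow (Sγ := Sγ) (m := r.1) r.2, (mem_ghostWindow (m := r.1)).mp (repWindow_subset hS r.2)⟩⟩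

/-- **THE REAL STRUCTURE OF THE WINDOW: `Φ(y₁, y₂) = R(y₁) + i·R(y₂)`** — a window configuration as (coordinates of a REAL
field) + i·(coordinates of a REAL field), `R = realifyWindow`. [cite: MagnenRivasseauSeneor1993, §II.A p.328 tl.12–17; (II.20) p.333 tl.35–37] -/
def realPair (y : (repWindow Sγ → ℝ) × (repWindow Sγ → ℝ)) : ghostWindow Sγ → ℝ :=
  realifyWindow ghostIm (ghostWindow Sγ) y.1 + iMul (realifyWindow ghostIm (ghostWindow Sγ) y.2)

/-- Its inverse, first component: `Re G₁(p) = (Re γ̃(p) + Re γ̃(−p))/2`, `Im G₁(p) = (Im γ̃(p) − Im γ̃(−p))/2`.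
[cite: MagnenRivasseauSeneor1993, §II.A p.328 tl.12–17] -/
def realPart1 (x : ghostWindow Sγ → ℝ) : repWindow Sγ → ℝ :=
  fun r => if r.1.2.2 then (x (repIn hS r) - x (partner hS r)) / 2 else (x (repIn hS r) + x (partner hS r)) / 2

/-- … second component: `Re G₂(p) = (Im γ̃(p) + Im γ̃(−p))/2`, `Im G₂(p) = −(Re γ̃(p) − Re γ̃(−p))/2`.
[cite: MagnenRivasseauSeneor1993, §II.A p.328 tl.12–17] -/
def realPart2 (x : ghostWindow Sγ → ℝ) : repWindow Sγ → ℝ :=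
  fun r => if r.1.2.2 then -(x (repIn hS (flipRep hS r)) - x (partner hS (flipRep hS r))) / 2
    else (x (repIn hS (flipRep hS r)) + x (partner hS (flipRep hS r))) / 2

/-- Flipping the imaginary-part flag twice is the identity. [cite: MagnenRivasseauSeneor1993, §II.A p.328 tl.12–17] -/
theorem flipRep_flipRep (r : repWindow Sγ) : flipRep hS (flipRep hS r) = r := by
  apply Subtype.ext
  simp [flipRep]

/-- `flipMode` of a representative mode is the flipped representative. [cite: MagnenRivasseauSeneor1993, §II.A p.328 tl.12–17] -/
theorem flipMode_repIn (r : repWindow Sγ) : flipMode (repIn hS r) = repIn hS (flipRep hS r) := rfl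

/-- `flipMode` of a partner mode is the partner of the flipped representative. [cite: MagnenRivasseauSeneor1993, §II.A p.328 tl.12–17] -/
theorem flipMode_partner (r : repWindow Sγ) : flipMode (partner hS r) = partner hS (flipRep hS r) := rfl

/-- `Φ(y₁,y₂)` at a representative mode `(p,a,b)`: `y₁(p,a,b) ± y₂(p,a,¬b)` (`+` for an imaginary part, `−` for a real
part: `Re(G₁ + iG₂) = Re G₁ − Im G₂`, `Im(G₁ + iG₂) = Im G₁ + Re G₂`). [cite: MagnenRivasseauSeneor1993, §II.A p.328 tl.12–17] -/
theorem realPair_apply_repIn (y : (repWindow Sγ → ℝ) × (repWindow Sγ → ℝ)) (r : repWindow Sγ) :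
    realPair y (repIn hS r) = y.1 r + (if r.1.2.2 then 1 else -1) * y.2 (flipRep hS r) := by
  unfold realPair
  rw [Pi.add_apply, realifyWindow_apply_repIn]
  unfold iMul
  rw [flipMode_repIn, realifyWindow_apply_repIn]
  rcases r with ⟨⟨p, a, b⟩, hr⟩
  cases b <;> simp [repIn]

/-- `Φ(y₁,y₂)` at the PARTNER mode `(−p,a,b)`: by reality of `G₁`, `G₂`, `Re(G₁+iG₂)(−p) = Re G₁(p) + Im G₂(p)` and
`Im(G₁+iG₂)(−p) = −Im G₁(p) + Re G₂(p)`. [cite: MagnenRivasseauSeneor1993, §II.A p.328 tl.12–17] -/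
theorem realPair_apply_partner (y : (repWindow Sγ → ℝ) × (repWindow Sγ → ℝ)) (r : repWindow Sγ) :
    realPair y (partner hS r) = (if r.1.2.2 then -1 else 1) * y.1 r + y.2 (flipRep hS r) := by
  unfold realPair
  rw [Pi.add_apply, realifyWindow_apply_partner]
  unfold iMul
  rw [flipMode_partner, realifyWindow_apply_partner]
  rcases r with ⟨⟨p, a, b⟩, hr⟩
  cases b <;> simp [partner, flipRep]

omit hS in
/-- `Φ` is additive … [cite: MagnenRivasseauSeneor1993, §II.A p.328 tl.12–17] -/
theorem realPair_add (y y' : (repWindow Sγ → ℝ) × (repWindow Sγ → ℝ)) :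
    realPair (y + y') = realPair y + realPair y' := by
  funext m
  simp only [realPair, Prod.fst_add, Prod.snd_add, realifyWindow_add, Pi.add_apply, iMul]
  split_ifs <;> ring

omit hS in
/-- … and `ℝ`-homogeneous. [cite: MagnenRivasseauSeneor1993, §II.A p.328 tl.12–17] -/
theorem realPair_smul (c : ℝ) (y : (repWindow Sγ → ℝ) × (repWindow Sγ → ℝ)) :
    realPair (c • y) = c • realPair y := by
  funext m
  simp only [realPair, Prod.smul_fst, Prod.smul_snd, realifyWindow_smul, Pi.add_apply, Pi.smul_apply, smul_eq_mul, iMul]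
  split_ifs <;> ring

/-- Left inverse, first component: `P₁(Φ(y₁,y₂)) = y₁`. [cite: MagnenRivasseauSeneor1993, §II.A p.328 tl.12–17] -/
theorem realPart1_realPair (y : (repWindow Sγ → ℝ) × (repWindow Sγ → ℝ)) : realPart1 hS (realPair y) = y.1 := by
  funext r
  unfold realPart1
  rw [realPair_apply_repIn, realPair_apply_partner]
  rcases r with ⟨⟨p, a, b⟩, hr⟩
  cases b
  · simp
    ring
  · simp

/-- Left inverse, second component: `P₂(Φ(y₁,y₂)) = y₂`. [cite: MagnenRivasseauSeneor1993, §II.A p.328 tl.12–17] -/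
theorem realPart2_realPair (y : (repWindow Sγ → ℝ) × (repWindow Sγ → ℝ)) : realPart2 hS (realPair y) = y.2 := by
  funext r
  unfold realPart2
  rw [realPair_apply_repIn, realPair_apply_partner, flipRep_flipRep]
  rcases r with ⟨⟨p, a, b⟩, hr⟩
  cases b
  · simp [flipRep]
    ring
  · simp [flipRep]

/-- Every mode of a window closed under `p ↦ −p` is a representative or the partner of one.
[cite: MagnenRivasseauSeneor1993, §II.A p.328 tl.12–17] -/
theorem eq_repIn_or_partner (m : ghostWindow Sγ) :
    (∃ r : repWindow Sγ, m = repIn hS r) ∨ (∃ r : repWindow Sγ, m = partner hS r) := by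
  have hm : m.1.1 ∈ Sγ := (mem_ghostWindow (m := m.1)).mp m.2
  by_cases hpos : m.1.1.IsPos
  · left
    exact ⟨⟨m.1, (mem_repWindow_iff hS (m := m.1)).mpr ⟨hpos, hm⟩⟩, Subtype.ext rfl⟩
  · right
    have hneg : m.1.1.neg.IsPos := (Momentum.isPos_or_isPos_neg m.1.1).resolve_left hpos
    refine ⟨⟨(m.1.1.neg, m.1.2), (mem_repWindow_iff hS (m := (m.1.1.neg, m.1.2))).mpr ⟨hneg, hS _ hm⟩⟩, ?_⟩
    apply Subtype.ext
    simp [partner, Momentum.neg_neg]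

/-- Right inverse: `Φ(P₁x, P₂x) = x`. [cite: MagnenRivasseauSeneor1993, §II.A p.328 tl.12–17] -/
theorem realPair_realPart (x : ghostWindow Sγ → ℝ) : realPair (realPart1 hS x, realPart2 hS x) = x := by
  funext m
  rcases eq_repIn_or_partner hS m with ⟨r, rfl⟩ | ⟨r, rfl⟩
  · rw [realPair_apply_repIn]
    simp only [realPart1, realPart2, flipRep_flipRep]
    rcases r with ⟨⟨p, a, b⟩, hr⟩
    cases b <;> simp [flipRep] <;> ring
  · rw [realPair_apply_partner]
    simp only [realPart1, realPart2, flipRep_flipRep]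
    rcases r with ⟨⟨p, a, b⟩, hr⟩
    cases b <;> simp [flipRep] <;> ring

/-- **THE WINDOW ≅ (REAL FIELDS) × (REAL FIELDS) as real vector spaces**: `Φ(y₁,y₂) = R(y₁) + i·R(y₂)` is a linear
isomorphism from pairs of independent coordinates onto all window coordinates (window closed under `p ↦ −p`).
[cite: MagnenRivasseauSeneor1993, §II.A p.328 tl.12–17; (II.20) p.333 tl.35–37] -/
def realEquiv : ((repWindow Sγ → ℝ) × (repWindow Sγ → ℝ)) ≃ₗ[ℝ] (ghostWindow Sγ → ℝ) where
  toFun := realPair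
  invFun x := (realPart1 hS x, realPart2 hS x)
  map_add' := realPair_add
  map_smul' := realPair_smul
  left_inv y := Prod.ext (realPart1_realPair hS y) (realPart2_realPair hS y)
  right_inv := realPair_realPart hS

/-- `Φ` evaluated. [cite: MagnenRivasseauSeneor1993, §II.A p.328 tl.12–17] -/
theorem realEquiv_apply (y : (repWindow Sγ → ℝ) × (repWindow Sγ → ℝ)) : realEquiv hS y = realPair y := rfl

/-- **`K_W(A)·Φ(y₁,y₂) = Φ(K^rep_W(A)·y₁, K^rep_W(A)·y₂)`** for a REAL cut-off field: on (real fields) ⊕ i·(real fields) the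
Faddeev–Popov window matrix acts as two copies of the representative matrix (§7's intertwining + `ℂ`-linearity).
[cite: MagnenRivasseauSeneor1993, (II.20) p.333 tl.29–37; §II.A p.328 tl.12–17] -/
theorem fpWindow_mulVec_realPair {T : Finset (Fin 4 → ℤ)} (hT : ∀ q ∈ T, -q ∈ T) (lam : ℝ) {A : VCoeff}
    (hA : IsRealVCoeff A) (y : (repWindow Sγ → ℝ) × (repWindow Sγ → ℝ)) :
    fpWindow Sγ T lam A *ᵥ realPair y =
      realPair (fpWindowRep Sγ T lam A *ᵥ y.1, fpWindowRep Sγ T lam A *ᵥ y.2) := by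
  unfold realPair
  rw [Matrix.mulVec_add, fpWindow_mulVec_realifyWindow hS hT lam hA, fpWindow_mulVec_iMul,
    fpWindow_mulVec_realifyWindow hS hT lam hA]

/-- The same as a conjugation of linear maps: `K_W(A) = Φ ∘ (K^rep_W(A) × K^rep_W(A)) ∘ Φ⁻¹`.
[cite: MagnenRivasseauSeneor1993, (II.20) p.333 tl.29–37; §II.A p.328 tl.12–17] -/
theorem toLin'_fpWindow_eq_conj {T : Finset (Fin 4 → ℤ)} (hT : ∀ q ∈ T, -q ∈ T) (lam : ℝ) {A : VCoeff}
    (hA : IsRealVCoeff A) :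
    Matrix.toLin' (fpWindow Sγ T lam A) =
      (realEquiv hS : _ →ₗ[ℝ] _) ∘ₗ
        ((Matrix.toLin' (fpWindowRep Sγ T lam A)).prodMap (Matrix.toLin' (fpWindowRep Sγ T lam A))) ∘ₗ
        ((realEquiv hS).symm : _ →ₗ[ℝ] _) := by
  apply LinearMap.ext
  intro x
  have hx : x = realEquiv hS ((realEquiv hS).symm x) := ((realEquiv hS).apply_symm_apply x).symm
  conv_lhs => rw [hx]
  simp only [LinearMap.coe_comp, LinearEquiv.coe_coe, Function.comp_apply, Matrix.toLin'_apply,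
    LinearMap.prodMap_apply, realEquiv_apply]
  exact fpWindow_mulVec_realPair hS hT lam hA _

/-- **`det K_W(A) = (det K^rep_W(A))²` FOR A REAL CUT-OFF FIELD** on a window closed under `p ↦ −p` (products cut off at a
set closed under `k ↦ −k`): the real determinant of a `ℂ`-linear operator commuting with conjugation is the square of
its determinant on the real fields. [cite: MagnenRivasseauSeneor1993, (II.20) p.333 tl.29–31; §II.A p.328 tl.12–17] -/
theorem det_fpWindow_eq_sq {T : Finset (Fin 4 → ℤ)} (hT : ∀ q ∈ T, -q ∈ T) (lam : ℝ) {A : VCoeff}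
    (hA : IsRealVCoeff A) :
    (fpWindow Sγ T lam A).det = (fpWindowRep Sγ T lam A).det ^ 2 := by
  rw [← LinearMap.det_toLin', toLin'_fpWindow_eq_conj hS hT lam hA, LinearMap.det_conj, LinearMap.det_prodMap,
    LinearMap.det_toLin', sq]

/-- Hence **`det K_W(A) ≥ 0`** for a real cut-off field: the SIGNED determinant printed in (II.20) is the absolute value.
[cite: MagnenRivasseauSeneor1993, (II.20) p.333 tl.29; (II.77) p.346 tl.19] -/
theorem det_fpWindow_nonneg {T : Finset (Fin 4 → ℤ)} (hT : ∀ q ∈ T, -q ∈ T) (lam : ℝ) {A : VCoeff}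
    (hA : IsRealVCoeff A) : 0 ≤ (fpWindow Sγ T lam A).det := by
  rw [det_fpWindow_eq_sq hS hT lam hA]
  positivity

/-- `|det K_W(A)| = det K_W(A)` for a real cut-off field. [cite: MagnenRivasseauSeneor1993, (II.20) p.333 tl.29] -/
theorem abs_det_fpWindow {T : Finset (Fin 4 → ℤ)} (hT : ∀ q ∈ T, -q ∈ T) (lam : ℝ) {A : VCoeff}
    (hA : IsRealVCoeff A) : |(fpWindow Sγ T lam A).det| = (fpWindow Sγ T lam A).det :=
  abs_of_nonneg (det_fpWindow_nonneg hS hT lam hA)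

/-- **(II.20) EXACTLY AS PRINTED — WITH THE SIGNED DETERMINANT «det[K(A)]» — for a REAL cut-off field on a window closed
under `p ↦ −p`**, whenever `K_W(A)` is invertible:
`det K_W(A) · (ζ/2π)^{|W|/2} · ∫dγ e^{−(ζ/2)Σ_{p∈Sγ}Σ_a|(∂_μA_μ^γ)~^a(p)|²} = 1` (gen 19's precision (ad) — «det» printed
without bars — is harmless here: the determinant is a square). [cite: MagnenRivasseauSeneor1993, (II.20) p.333 tl.27–31; §II.A p.328 tl.12–17] -/
theorem fp_unity_signed_window_of_det_ne_zero {T : Finset (Fin 4 → ℤ)} (hT : ∀ q ∈ T, -q ∈ T) (lam : ℝ)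
    {A : VCoeff} (hA : IsRealVCoeff A) (hdet : (fpWindow Sγ T lam A).det ≠ 0) {ζ : ℝ} (hζ : 0 < ζ) :
    (fpWindow Sγ T lam A).det * Real.sqrt (ζ / (2 * Real.pi)) ^ Fintype.card (ghostWindow Sγ) *
      ∫ x : ghostWindow Sγ → ℝ, Real.exp (-(ζ / 2) *
        ∑ p ∈ Sγ, ∑ a : Fin 3, Complex.normSq (divCoeff (gaugeInfCoeff T lam A (gcoeffW Sγ x)) p.1 a)) = 1 := by
  rw [← abs_det_fpWindow hS hT lam hA]
  exact fp_unity_window_of_det_ne_zero Sγ T lam A hdet hζ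

/-- **(II.20) AS PRINTED (signed determinant) for a real cut-off field, for ALL BUT FINITELY MANY couplings.**
[cite: MagnenRivasseauSeneor1993, (II.20) p.333 tl.27–34; §II.A p.328 tl.12–17] -/
theorem fp_unity_signed_window_cofinite {T : Finset (Fin 4 → ℤ)} (hT : ∀ q ∈ T, -q ∈ T) {A : VCoeff}
    (hA : IsRealVCoeff A) {ζ : ℝ} (hζ : 0 < ζ) :
    ∀ᶠ lam in Filter.cofinite, (fpWindow Sγ T lam A).det * Real.sqrt (ζ / (2 * Real.pi)) ^ Fintype.card (ghostWindow Sγ) *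
      ∫ x : ghostWindow Sγ → ℝ, Real.exp (-(ζ / 2) *
        ∑ p ∈ Sγ, ∑ a : Fin 3, Complex.normSq (divCoeff (gaugeInfCoeff T lam A (gcoeffW Sγ x)) p.1 a)) = 1 :=
  (det_fpWindow_ne_zero_cofinite Sγ T A).mono fun lam h => fp_unity_signed_window_of_det_ne_zero hS hT lam hA h hζ

/-- … and for all couplings in a neighbourhood of `0`. [cite: MagnenRivasseauSeneor1993, (II.20) p.333 tl.27–31; p.329 tl.14–15] -/
theorem fp_unity_signed_window {T : Finset (Fin 4 → ℤ)} (hT : ∀ q ∈ T, -q ∈ T) {A : VCoeff}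
    (hA : IsRealVCoeff A) {ζ : ℝ} (hζ : 0 < ζ) :
    ∀ᶠ lam in nhds (0 : ℝ), (fpWindow Sγ T lam A).det * Real.sqrt (ζ / (2 * Real.pi)) ^ Fintype.card (ghostWindow Sγ) *
      ∫ x : ghostWindow Sγ → ℝ, Real.exp (-(ζ / 2) *
        ∑ p ∈ Sγ, ∑ a : Fin 3, Complex.normSq (divCoeff (gaugeInfCoeff T lam A (gcoeffW Sγ x)) p.1 a)) = 1 :=
  (det_fpWindow_eventually_ne_zero Sγ T A).mono fun lam h => fp_unity_signed_window_of_det_ne_zero hS hT lam hA h hζ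

end SignedDeterminant

end FaddeevPopovUnity

end Literature.MathematicalPhysics.QuantumFieldTheory.MagnenRivasseauSeneor1993
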